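import Literature.Geometry.Riemannian.AubinYamabeSphereProofs
import Literature.Geometry.Lorentzian.EndChartIntegral
import Literature.Analysis.FluidPDE.WholeSpaceIBPIntegrable
import Mathlib.Analysis.Calculus.Gradient.Basic
import Mathlib.Analysis.SpecialFunctions.JapaneseBracket
import Mathlib.MeasureTheory.Function.L2Space
import HarnessLib

/-!
# `Y(S⁴,[g_S]) ≥ 8√6 π` from the sharp Sobolev inequality on `ℝ⁴` (stereographic transfer)

Second proof file for the named fact `yamabe_roundMetric_sphere_four` (`AubinYamabeSphere.lean`;
Aubin 1982, Thm. 6.12 on `S⁴`, metric form). `AubinYamabeSphereProofs.lean` reduced the fact to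
the sharp Sobolev inequality (⋆) ON THE ROUND SPHERE (its function form (11)). Aubin's own
architecture obtains the constant of Thm. 6.12 from the best constant `K(n,2)` of the Sobolev
inequality ON `ℝⁿ` (Thm. 2.14: `‖φ‖_N ≤ K(n,2)‖∇φ‖₂`, `K(n,2) = 2ω_n^{-1/n}(n(n−2))^{-1/2}`;
`n = 4`: `K(4,2)² = ω₄^{-1/2}/2 = √6/(8π)`, i.e. `8√6 π ‖u‖²_{L⁴(ℝ⁴)} ≤ 6 ‖∇u‖²_{L²(ℝ⁴)}`)
through the conformal invariance of the Yamabe functional under stereographic projection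
(Prop. 6.4; Lee–Parker 1987, §3, proof of Thm. 3.3: "`λ(Sⁿ) = Λ`", `Λ` the sharp Euclidean
constant, "the Yamabe functional is conformally invariant and stereographic projection is
conformal"). THIS FILE FORMALISES THAT TRANSFER: `yamabe_roundMetric_sphere_four_of_euclidean` —
**the sharp Sobolev inequality on `𝒟(ℝ⁴)` (smooth compactly supported functions:
`8√6 π (∫ φ⁴)^{1/2} ≤ 6 ∫ |∇φ|²`, i.e. Thm. 2.14 with `q = 2`, `n = 4` on `𝒟(ℝ⁴) ⊂ H₁`) implies
`yamabe_roundMetric_sphere_four`** (via `yamabe_roundMetric_sphere_four_of_euclidean_decay`, the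
same from the inequality for smooth positive `u ∈ L⁴` with `∇u ∈ L²`, and the truncation
lemma `sobolev_of_compactSupport`).

The transfer, for `ψ` smooth positive on `S⁴` and `σ = extChartAt (𝓡 4) v` Mathlib's
stereographic chart (all of `S⁴` but the point `−v`), with `ψ̃ = ψ ∘ σ⁻¹` and the conformal
factor `c(y) = 4/(‖y‖²+4)` (`σ⁻¹^* g_S = c² δ`, `RoundSphereVolume.lean`), sets `u = c ψ̃` and
checks (Lee–Parker 1987, (3.3)–(3.5); Aubin 1982, §6.4 with §6.3 (1) for `g' = c² δ`):

* `∫_{S⁴} F dV = ∫_{ℝ⁴} c⁴ F(σ⁻¹y) dy` (`integral_roundMetric_eq_integral_chart`: chart formula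
  `map_extChartAt_restrict_riemannianMeasure`, `√det = c⁴`, and the missing point is null);
* `|dψ|²_{g_S}(σ⁻¹ y) = c⁻² |∇ψ̃(y)|²` (`innerDual_mvfderiv_roundMetric_extChartAt_symm`:
  naturality of `g⁻¹` under the chart, `innerDual_mvfderiv_comp`, and `♯` for the metric `c² δ`);
* hence `∫_{S⁴} ψ⁴ dV = ∫ u⁴`, `∫_{S⁴} 6|dψ|² dV = 6∫ c²|∇ψ̃|²`, `∫_{S⁴} 12ψ² dV = 12∫ c⁴ψ̃²`;
* `6∫|∇u|² = 6∫ c²|∇ψ̃|² + 6∫ (2cψ̃⟨∇c,∇ψ̃⟩ + ψ̃²|∇c|²)` and the last integral is `12∫ c⁴ ψ̃²`,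
  because `div(ψ̃² c ∇c) = 2cψ̃⟨∇c,∇ψ̃⟩ + ψ̃²|∇c|² + ψ̃² c Δc` with `Δc = −2c³`
  (`divergence_gradConfFactor_four`; this is Aubin's eq. (1) of §6.3 for the flat metric and
  `g' = c² δ`: `6(−Δc) + 0 = R' c³ = 12 c³` in his convention `Δ = −∇^ν∇_ν`) and
  `∫ div(ψ̃² c ∇c) = 0` by the `L¹` divergence theorem
  (`integral_mul_divergence_add_eq_zero_of_integrable`, `WholeSpaceIBPIntegrable.lean`; the field
  decays only like `|y|⁻⁵`, below the threshold of the power-decay Green formula);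
* so `6∫|∇u|² = ∫_{S⁴} (6|dψ|² + 12ψ²) dV` — the conformal invariance of the Yamabe functional —
  and the Euclidean inequality for `u` is exactly (⋆) for `ψ`
  (`yamabe_roundMetric_sphere_four_of_sharpSobolev`).

Everything is proved; no definitions (the conformal factor and its gradient
`Z(y) = −8(‖y‖²+4)⁻² y` are written out), no named facts. What is NOT here: the Euclidean sharp
Sobolev inequality itself (Aubin 1976, Talenti 1976; Aubin 1982, Thm. 2.14) — hypothesis `hE`.

## References

* T. Aubin, *Nonlinear Analysis on Manifolds. Monge–Ampère Equations*, Springer 1982, Thm. 2.14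
  (`K(n,2)`), Ch. 6, §6.3 (1), §6.4 and Prop. 6.4, Thm. 6.12. [Aubin1982]
* T. Aubin, J. Diff. Geom. 11 (1976) 573–598 (best Sobolev constants). [Aubin1976]
* J. M. Lee, T. H. Parker, *The Yamabe problem*, Bull. AMS 17 (1987), §3, Thm. 3.3 and
  (3.3)–(3.5) (stereographic projection, `λ(Sⁿ) = Λ = n(n−1)ω_n^{2/n}`). [LeeParker1987]
* J. M. Lee, *Introduction to Riemannian Manifolds*, 2nd ed. 2018, Ch. 3 (stereographic
  coordinates are conformal). [Lee2018]
* E. H. Lieb, M. Loss, *Analysis*, 2nd ed., AMS 2001, Thm. 8.3 (sharp Sobolev inequality on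
  `D¹(ℝⁿ)`, `n ≥ 3`). [LiebLoss2001]
* G. Talenti, *Best constant in Sobolev inequality*, Ann. Mat. Pura Appl. 110 (1976) 353–372.
-/

noncomputable section

open scoped RealInnerProductSpace Manifold ContDiff Topology Gradient
-- Mathlib's scoped instance `Fact (finrank ℝ (EuclideanSpace ℝ (Fin n)) = n)`, feeding the
-- `[Fact (finrank ℝ V = n + 1)]` hypotheses of the sphere API
open scoped EuclideanSpace
open Metric Module Bundle Set MeasureTheory Filter InnerProductSpace Function

namespace Literature.Geometry.Riemannian

open Literature.Geometry.Lorentzian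
open Literature.Geometry.Lorentzian.PseudoRiemannianMetric
open Literature.Analysis.FluidPDE

/-! ### The conformal factor `c(y) = 4/(‖y‖²+4)` and its gradient `Z(y) = −8(‖y‖²+4)⁻² y` -/

section ConformalFactor

variable {E : Type*} [NormedAddCommGroup E] [InnerProductSpace ℝ E]

/-- The differential of the conformal factor `c(y) = 4/(‖y‖²+4)`:
`Dc(y) = −8(‖y‖²+4)⁻² ⟪y, ·⟫`. [folklore] -/
theorem hasFDerivAt_confFactor (y : E) :
    HasFDerivAt (fun y : E ↦ 4 / (‖y‖ ^ 2 + 4)) (-(8 / (‖y‖ ^ 2 + 4) ^ 2) • innerSL ℝ y) y := by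
  have h₀ : HasFDerivAt (fun w : E => ‖w‖ ^ 2) (2 • innerSL ℝ y) y :=
    (hasStrictFDerivAt_norm_sq y).hasFDerivAt
  have hpos : (‖y‖ ^ 2 + 4) ≠ 0 := by positivity
  have h₁ : HasFDerivAt (fun w : E => (‖w‖ ^ 2 + 4)⁻¹)
      ((-((‖y‖ ^ 2 + 4) ^ 2)⁻¹) • (2 • innerSL ℝ y)) y := by
    have := (hasDerivAt_inv hpos).comp_hasFDerivAt y (h₀.add_const 4)
    simpa [Function.comp_def] using this
  have h₂ := h₁.const_mul (4 : ℝ)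
  simp only [div_eq_mul_inv]
  refine h₂.congr_fderiv ?_
  ext w
  simp only [smul_apply, innerSL_apply_apply, smul_eq_mul, nsmul_eq_mul, Nat.cast_ofNat, neg_mul]
  ring

/-- `c` is smooth. [folklore] -/
theorem contDiff_confFactor {m : ℕ∞ω} : ContDiff ℝ m (fun y : E ↦ 4 / (‖y‖ ^ 2 + 4)) := by
  refine ContDiff.div contDiff_const ((contDiff_norm_sq ℝ).add contDiff_const) fun y ↦ ?_
  positivity

/-- The differential of `Z(y) = −8(‖y‖²+4)⁻² y`:
`DZ(y) = −8(‖y‖²+4)⁻² id + 32(‖y‖²+4)⁻³ ⟪y, ·⟫ y`. [folklore] -/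
theorem hasFDerivAt_gradConfFactor (y : E) :
    HasFDerivAt (fun y : E ↦ -(8 / (‖y‖ ^ 2 + 4) ^ 2) • y)
      (-(8 / (‖y‖ ^ 2 + 4) ^ 2) • ContinuousLinearMap.id ℝ E +
        ((32 / (‖y‖ ^ 2 + 4) ^ 3) • innerSL ℝ y).smulRight y) y := by
  have h₀ : HasFDerivAt (fun w : E => ‖w‖ ^ 2) (2 • innerSL ℝ y) y :=
    (hasStrictFDerivAt_norm_sq y).hasFDerivAt
  have hpos : (‖y‖ ^ 2 + 4) ≠ 0 := by positivity
  have h₁ : HasFDerivAt (fun w : E ↦ -(8 / (‖w‖ ^ 2 + 4) ^ 2))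
      ((32 / (‖y‖ ^ 2 + 4) ^ 3) • innerSL ℝ y) y := by
    have h2 := (h₀.add_const 4).pow 2
    have h3 := (hasDerivAt_inv (pow_ne_zero 2 hpos)).comp_hasFDerivAt y h2
    have h4 := h3.const_mul (-8 : ℝ)
    simp only [div_eq_mul_inv, ← neg_mul]
    refine h4.congr_fderiv ?_
    ext w
    simp only [smul_apply, innerSL_apply_apply, smul_eq_mul, nsmul_eq_mul, Nat.cast_ofNat]
    field_simp
    ring
  exact h₁.smul (hasFDerivAt_id y)

/-- `Z` is smooth. [folklore] -/
theorem contDiff_gradConfFactor {m : ℕ∞ω} :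
    ContDiff ℝ m (fun y : E ↦ -(8 / (‖y‖ ^ 2 + 4) ^ 2) • y) := by
  refine ContDiff.smul ?_ contDiff_id
  refine (ContDiff.div contDiff_const (((contDiff_norm_sq ℝ).add contDiff_const).pow 2)
    fun y ↦ ?_).neg
  positivity

/-- **`Δc = div Z = −8 dim E/(‖y‖²+4)² + 32‖y‖²/(‖y‖²+4)³`** (trace of `DZ` in an orthonormal
basis, Parseval). [folklore] -/
theorem divergence_gradConfFactor [FiniteDimensional ℝ E] (y : E) :
    VectorCalculus.divergence (fun y : E ↦ -(8 / (‖y‖ ^ 2 + 4) ^ 2) • y) y =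
      -(8 / (‖y‖ ^ 2 + 4) ^ 2) * finrank ℝ E + 32 / (‖y‖ ^ 2 + 4) ^ 3 * ‖y‖ ^ 2 := by
  set b := stdOrthonormalBasis ℝ E
  rw [divergence_eq_sum_inner_fderiv b, (hasFDerivAt_gradConfFactor y).fderiv]
  simp only [add_apply, smul_apply, ContinuousLinearMap.id_apply,
    ContinuousLinearMap.smulRight_apply, innerSL_apply_apply, inner_add_right, inner_smul_right,
    real_inner_self_eq_norm_sq, b.orthonormal.1, one_pow, mul_one, Finset.sum_add_distrib,
    Finset.sum_const, Finset.card_univ, smul_eq_mul]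
  simp only [Fintype.card_fin, nsmul_eq_mul]
  have hpar : ∑ i, ⟪y, b i⟫ * ⟪b i, y⟫ = ‖y‖ ^ 2 := by
    rw [b.sum_inner_mul_inner, real_inner_self_eq_norm_sq]
  have hsum : ∑ i, 32 / (‖y‖ ^ 2 + 4) ^ 3 * ⟪y, b i⟫ * ⟪b i, y⟫ =
      32 / (‖y‖ ^ 2 + 4) ^ 3 * ‖y‖ ^ 2 := by
    rw [← hpar, Finset.mul_sum]
    refine Finset.sum_congr rfl fun i _ ↦ ?_
    ring
  rw [hsum]
  ring

/-- **In dimension `4`: `Δc = div Z = −128/(‖y‖²+4)³ = −2 c³`** — Aubin's equation (1) of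
§6.3 for the flat metric and `g' = c² δ` (round): `6Δc + 0 = 12 c³` with `Δ = −∇^ν∇_ν`.
[cite: Aubin1982, Ch. 6, §6.3, eq. (1)] -/
theorem divergence_gradConfFactor_four [FiniteDimensional ℝ E] (h4 : finrank ℝ E = 4) (y : E) :
    VectorCalculus.divergence (fun y : E ↦ -(8 / (‖y‖ ^ 2 + 4) ^ 2) • y) y =
      -2 * (4 / (‖y‖ ^ 2 + 4)) ^ 3 := by
  rw [divergence_gradConfFactor, h4]
  have hpos : (‖y‖ ^ 2 + 4) ≠ 0 := by positivity
  field_simp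
  ring

variable [CompleteSpace E]

/-- The gradient of `c` is `Z`: `∇c(y) = −8(‖y‖²+4)⁻² y`. [folklore] -/
theorem gradient_confFactor (y : E) :
    ∇ (fun y : E ↦ 4 / (‖y‖ ^ 2 + 4)) y = -(8 / (‖y‖ ^ 2 + 4) ^ 2) • y := by
  refine HasGradientAt.gradient ?_
  rw [hasGradientAt_iff_hasFDerivAt]
  refine (hasFDerivAt_confFactor y).congr_fderiv ?_
  ext w
  simp [toDual_apply_apply, innerSL_apply_apply]

/-- **Product rule for the gradient**: `∇(fg) = f ∇g + g ∇f` at points of differentiability.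
[folklore] -/
theorem gradient_mul {f g : E → ℝ} {x : E} (hf : DifferentiableAt ℝ f x)
    (hg : DifferentiableAt ℝ g x) : ∇ (fun y ↦ f y * g y) x = f x • ∇ g x + g x • ∇ f x := by
  refine HasGradientAt.gradient ?_
  rw [hasGradientAt_iff_hasFDerivAt]
  refine (hf.hasFDerivAt.mul hg.hasFDerivAt).congr_fderiv ?_
  simp only [map_add, map_smul, toDual_gradient]

/-! ### Elementary bounds on `c` and `Z` -/

omit [InnerProductSpace ℝ E] [CompleteSpace E] in
/-- `(1 + ‖y‖)² ≤ 2(‖y‖² + 4)`. [folklore] -/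
theorem one_add_norm_sq_le (y : E) : (1 + ‖y‖) ^ 2 ≤ 2 * (‖y‖ ^ 2 + 4) := by
  nlinarith [norm_nonneg y, sq_nonneg (‖y‖ - 1)]

omit [InnerProductSpace ℝ E] [CompleteSpace E] in
/-- `c(y) ≤ 8 (1+‖y‖)⁻²`. [folklore] -/
theorem confFactor_le (y : E) : 4 / (‖y‖ ^ 2 + 4) ≤ 8 / (1 + ‖y‖) ^ 2 := by
  have h := one_add_norm_sq_le y
  have h1 : 0 < (1 + ‖y‖) ^ 2 := by positivity
  rw [div_le_div_iff₀ (by positivity) h1]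
  nlinarith

omit [CompleteSpace E] in
/-- `‖Z(y)‖ = 8‖y‖/(‖y‖²+4)² ≤ 32 (1+‖y‖)⁻³`. [folklore] -/
theorem norm_gradConfFactor_le (y : E) :
    ‖-(8 / (‖y‖ ^ 2 + 4) ^ 2) • y‖ ≤ 32 / (1 + ‖y‖) ^ 3 := by
  have h := one_add_norm_sq_le y
  have h1 : 0 < 1 + ‖y‖ := by positivity
  rw [norm_smul, norm_neg, Real.norm_of_nonneg (by positivity),
    div_mul_eq_mul_div, div_le_div_iff₀ (by positivity) (by positivity)]
  have h2 : ‖y‖ ≤ 1 + ‖y‖ := by linarith [norm_nonneg y]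
  have h3 : (1 + ‖y‖) ^ 4 ≤ 4 * (‖y‖ ^ 2 + 4) ^ 2 := by nlinarith [h, sq_nonneg (1 + ‖y‖)]
  calc 8 * ‖y‖ * (1 + ‖y‖) ^ 3 ≤ 8 * (1 + ‖y‖) * (1 + ‖y‖) ^ 3 := by gcongr
    _ = 8 * (1 + ‖y‖) ^ 4 := by ring
    _ ≤ 8 * (4 * (‖y‖ ^ 2 + 4) ^ 2) := by gcongr
    _ = 32 * (‖y‖ ^ 2 + 4) ^ 2 := by ring

end ConformalFactor

/-! ### An `L¹` integration by parts against `∇c` in dimension four -/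

section IBP

variable {E : Type*} [NormedAddCommGroup E] [InnerProductSpace ℝ E] [FiniteDimensional ℝ E]
  [MeasurableSpace E] [BorelSpace E]

/-- Integrability from a power bound `‖f‖ ≤ K (1+‖y‖)⁻ᵏ` with `dim E < k`
(`integrable_one_add_norm`). [folklore] -/
theorem integrable_of_le_one_add_norm_pow {F : Type*} [NormedAddCommGroup F] {f : E → F}
    (hf : AEStronglyMeasurable f) {K : ℝ} {k : ℕ} (hk : finrank ℝ E < k)
    (hbound : ∀ y, ‖f y‖ ≤ K / (1 + ‖y‖) ^ k) : Integrable f := by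
  have hint : Integrable (fun y : E ↦ K * (1 + ‖y‖) ^ (-(k : ℝ))) :=
    (integrable_one_add_norm (by exact_mod_cast hk)).const_mul K
  refine hint.mono' hf (Eventually.of_forall fun y ↦ ?_)
  rw [Real.rpow_neg (by positivity), Real.rpow_natCast, ← div_eq_mul_inv]
  exact hbound y

/-- **The key integration by parts** (dimension `4`): for `φ ∈ C¹(E)` bounded, `|φ| ≤ M`, with
gradient decaying like the conformal factor, `‖∇φ(y)‖ ≤ M' c(y)`, and `Z = ∇c`:
`∫ (φ² ‖Z‖² + 2 c φ ⟪Z, ∇φ⟫) = 2 ∫ c⁴ φ²`, all integrands being integrable. This is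
`∫ div(φ² c ∇c) = 0` (`integral_mul_divergence_add_eq_zero_of_integrable`: `φ² c ∇c ∈ L¹`,
decaying like `|y|⁻⁵`) with `div ∇c = −2c³` (`divergence_gradConfFactor_four`) and
`∇(φ² c) = φ² Z + 2 c φ ∇φ`. [cite: LeeParker1987, §3, (3.4)] -/
theorem integral_conformal_cross_terms (h4 : finrank ℝ E = 4) {φ : E → ℝ} (hφ : ContDiff ℝ 1 φ)
    {M M' : ℝ} (hM : ∀ y, |φ y| ≤ M) (hM' : ∀ y, ‖∇ φ y‖ ≤ M' * (4 / (‖y‖ ^ 2 + 4))) :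
    Integrable (fun y : E ↦ φ y ^ 2 * ‖-(8 / (‖y‖ ^ 2 + 4) ^ 2) • y‖ ^ 2 +
        2 * (4 / (‖y‖ ^ 2 + 4)) * φ y * ⟪-(8 / (‖y‖ ^ 2 + 4) ^ 2) • y, ∇ φ y⟫) ∧
      ∫ y, (φ y ^ 2 * ‖-(8 / (‖y‖ ^ 2 + 4) ^ 2) • y‖ ^ 2 +
          2 * (4 / (‖y‖ ^ 2 + 4)) * φ y * ⟪-(8 / (‖y‖ ^ 2 + 4) ^ 2) • y, ∇ φ y⟫) =
        2 * ∫ y, (4 / (‖y‖ ^ 2 + 4)) ^ 4 * φ y ^ 2 := by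
  haveI : CompleteSpace E := FiniteDimensional.complete ℝ E
  have hM0 : 0 ≤ M := (abs_nonneg _).trans (hM 0)
  have hM'0 : 0 ≤ M' := by
    have h := (norm_nonneg _).trans (hM' 0)
    have hc : (0 : ℝ) < 4 / (‖(0 : E)‖ ^ 2 + 4) := by positivity
    nlinarith
  -- notation-free abbreviations
  set c : E → ℝ := fun y ↦ 4 / (‖y‖ ^ 2 + 4) with hc
  set Z : E → E := fun y ↦ -(8 / (‖y‖ ^ 2 + 4) ^ 2) • y with hZ
  have hcpos : ∀ y, 0 < c y := fun y ↦ by rw [hc]; positivity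
  have hcle1 : ∀ y, c y ≤ 1 := fun y ↦ by
    rw [hc]
    simp only
    rw [div_le_one (by positivity)]
    nlinarith [norm_nonneg y]
  have hcle : ∀ y, c y ≤ 8 / (1 + ‖y‖) ^ 2 := confFactor_le
  have hZle : ∀ y, ‖Z y‖ ≤ 32 / (1 + ‖y‖) ^ 3 := norm_gradConfFactor_le
  -- smoothness
  have hcs : ContDiff ℝ 1 c := contDiff_confFactor
  have hZs : ContDiff ℝ 1 Z := contDiff_gradConfFactor
  have hθ : ContDiff ℝ 1 (fun y ↦ φ y ^ 2 * c y) := (hφ.pow 2).mul hcs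
  have hφd : ∀ y, DifferentiableAt ℝ φ y := fun y ↦ hφ.differentiable one_ne_zero y
  have hcd : ∀ y, DifferentiableAt ℝ c y := fun y ↦ hcs.differentiable one_ne_zero y
  -- the gradient of `θ = φ² c`
  have hgradc : ∀ y, ∇ c y = Z y := gradient_confFactor
  have hgradsq : ∀ y, ∇ (fun y ↦ φ y ^ 2) y = (2 * φ y) • ∇ φ y := fun y ↦ by
    have h := gradient_mul (hφd y) (hφd y)
    simp only [← sq] at h
    rw [h, ← add_smul, ← two_mul]
  have hgradθ : ∀ y, ∇ (fun y ↦ φ y ^ 2 * c y) y = (φ y ^ 2) • Z y + c y • ((2 * φ y) • ∇ φ y) :=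
    fun y ↦ by
    have hφ2d : DifferentiableAt ℝ (fun y ↦ φ y ^ 2) y := (hφd y).pow 2
    rw [gradient_mul hφ2d (hcd y), hgradc, hgradsq]
  -- continuity of everything (for measurability)
  have hφc : Continuous φ := hφ.continuous
  have hcc : Continuous c := hcs.continuous
  have hZc : Continuous Z := hZs.continuous
  have hgφc : Continuous (∇ φ) := continuous_gradient_of_contDiff hφ
  -- the divergence
  have hdiv : ∀ y, VectorCalculus.divergence Z y = -2 * c y ^ 3 := divergence_gradConfFactor_four h4
  -- integrability of the three IBP inputs
  have hk5 : finrank ℝ E < 5 := by rw [h4]; norm_num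
  have hk6 : finrank ℝ E < 6 := by rw [h4]; norm_num
  have hpow : ∀ (y : E) (k : ℕ), 0 < (1 + ‖y‖) ^ k := fun y k ↦ by positivity
  have hI1 : Integrable (fun y ↦ (φ y ^ 2 * c y) • Z y) := by
    refine integrable_of_le_one_add_norm_pow
      ((((hφc.pow 2).mul hcc).smul hZc).aestronglyMeasurable) (K := M ^ 2 * 8 * 32) hk5
      fun y ↦ ?_
    rw [norm_smul, norm_mul, Real.norm_of_nonneg (sq_nonneg _), Real.norm_of_nonneg (hcpos y).le]
    have h1 : φ y ^ 2 ≤ M ^ 2 := by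
      have := hM y
      rw [← sq_abs]
      exact pow_le_pow_left₀ (abs_nonneg _) this 2
    calc φ y ^ 2 * c y * ‖Z y‖ ≤ M ^ 2 * (8 / (1 + ‖y‖) ^ 2) * (32 / (1 + ‖y‖) ^ 3) := by
          gcongr
          · exact hcle y
          · exact hZle y
      _ = M ^ 2 * 8 * 32 / (1 + ‖y‖) ^ 5 := by
          field_simp
  have hI2 : Integrable (fun y ↦ φ y ^ 2 * c y * VectorCalculus.divergence Z y) := by
    simp_rw [hdiv]
    refine integrable_of_le_one_add_norm_pow
      (((hφc.pow 2).mul hcc).mul (continuous_const.mul (hcc.pow 3))).aestronglyMeasurable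
      (K := M ^ 2 * 2 * 8 ^ 4) (k := 8) (by rw [h4]; norm_num) fun y ↦ ?_
    rw [Real.norm_eq_abs, abs_mul, abs_mul, abs_of_nonneg (sq_nonneg _),
      abs_of_nonneg (hcpos y).le, abs_mul, abs_of_nonneg (pow_nonneg (hcpos y).le 3)]
    have h1 : φ y ^ 2 ≤ M ^ 2 := by
      rw [← sq_abs]; exact pow_le_pow_left₀ (abs_nonneg _) (hM y) 2
    have h2 : c y ^ 4 ≤ (8 / (1 + ‖y‖) ^ 2) ^ 4 := pow_le_pow_left₀ (hcpos y).le (hcle y) 4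
    calc φ y ^ 2 * c y * (|(-2 : ℝ)| * c y ^ 3) = 2 * (φ y ^ 2 * c y ^ 4) := by
          rw [abs_neg, abs_two]; ring
      _ ≤ 2 * (M ^ 2 * (8 / (1 + ‖y‖) ^ 2) ^ 4) :=
          mul_le_mul_of_nonneg_left (mul_le_mul h1 h2 (by positivity) (sq_nonneg M)) zero_le_two
      _ = M ^ 2 * 2 * 8 ^ 4 / (1 + ‖y‖) ^ 8 := by
          field_simp
  have hB1 : ∀ y : E, 1 ≤ 1 + ‖y‖ := fun y ↦ le_add_of_nonneg_right (norm_nonneg y)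
  have hsq : ∀ y, φ y ^ 2 ≤ M ^ 2 := fun y ↦ by
    rw [← sq_abs]; exact pow_le_pow_left₀ (abs_nonneg _) (hM y) 2
  -- pointwise form of `⟪Z, ∇θ⟫`
  have hinner : ∀ y, ⟪Z y, ∇ (fun y ↦ φ y ^ 2 * c y) y⟫ =
      φ y ^ 2 * ‖Z y‖ ^ 2 + 2 * c y * φ y * ⟪Z y, ∇ φ y⟫ := fun y ↦ by
    rw [hgradθ, inner_add_right, inner_smul_right, real_inner_self_eq_norm_sq, inner_smul_right,
      inner_smul_right]
    ring
  have hI3 : Integrable (fun y ↦ ⟪Z y, ∇ (fun y ↦ φ y ^ 2 * c y) y⟫) := by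
    simp_rw [hinner]
    refine integrable_of_le_one_add_norm_pow
      ((((hφc.pow 2).mul ((hZc.norm).pow 2)).add
        (((continuous_const.mul hcc).mul hφc).mul (hZc.inner hgφc))).aestronglyMeasurable)
      (K := M ^ 2 * 32 ^ 2 + 2 * 8 * M * (32 * (M' * 8))) hk6 fun y ↦ ?_
    have hB := hB1 y
    have hBpos : 0 < 1 + ‖y‖ := by positivity
    -- first term
    have h1 : |φ y ^ 2 * ‖Z y‖ ^ 2| ≤ M ^ 2 * 32 ^ 2 / (1 + ‖y‖) ^ 6 := by
      rw [abs_of_nonneg (by positivity)]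
      have hZ2 : ‖Z y‖ ^ 2 ≤ (32 / (1 + ‖y‖) ^ 3) ^ 2 :=
        pow_le_pow_left₀ (norm_nonneg _) (hZle y) 2
      calc φ y ^ 2 * ‖Z y‖ ^ 2 ≤ M ^ 2 * (32 / (1 + ‖y‖) ^ 3) ^ 2 :=
            mul_le_mul (hsq y) hZ2 (sq_nonneg _) (sq_nonneg M)
        _ = M ^ 2 * 32 ^ 2 / (1 + ‖y‖) ^ 6 := by
            field_simp
    -- second term
    have h2 : |2 * c y * φ y * ⟪Z y, ∇ φ y⟫| ≤ 2 * 8 * M * (32 * (M' * 8)) / (1 + ‖y‖) ^ 6 := by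
      rw [abs_mul, abs_mul, abs_mul, abs_two, abs_of_nonneg (hcpos y).le]
      have hin : |⟪Z y, ∇ φ y⟫| ≤ ‖Z y‖ * ‖∇ φ y‖ := abs_real_inner_le_norm _ _
      have hgrad : ‖∇ φ y‖ ≤ M' * (8 / (1 + ‖y‖) ^ 2) :=
        (hM' y).trans (mul_le_mul_of_nonneg_left (hcle y) hM'0)
      have hcy : c y ≤ 8 / (1 + ‖y‖) ^ 2 := hcle y
      calc 2 * c y * |φ y| * |⟪Z y, ∇ φ y⟫|
          ≤ 2 * (8 / (1 + ‖y‖) ^ 2) * M * ((32 / (1 + ‖y‖) ^ 3) * (M' * (8 / (1 + ‖y‖) ^ 2))) := by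
            have ha : 2 * c y * |φ y| ≤ 2 * (8 / (1 + ‖y‖) ^ 2) * M :=
              mul_le_mul (mul_le_mul_of_nonneg_left hcy zero_le_two) (hM y) (abs_nonneg _)
                (by positivity)
            have hb : |⟪Z y, ∇ φ y⟫| ≤ (32 / (1 + ‖y‖) ^ 3) * (M' * (8 / (1 + ‖y‖) ^ 2)) :=
              hin.trans (mul_le_mul (hZle y) hgrad (norm_nonneg _) (by positivity))
            exact mul_le_mul ha hb (abs_nonneg _) (by positivity)
        _ = 2 * 8 * M * (32 * (M' * 8)) / (1 + ‖y‖) ^ 7 := by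
            field_simp
        _ ≤ 2 * 8 * M * (32 * (M' * 8)) / (1 + ‖y‖) ^ 6 := by
            apply div_le_div_of_nonneg_left (by positivity) (by positivity)
            exact pow_le_pow_right₀ hB (by norm_num)
    rw [Real.norm_eq_abs]
    calc |φ y ^ 2 * ‖Z y‖ ^ 2 + 2 * c y * φ y * ⟪Z y, ∇ φ y⟫|
        ≤ |φ y ^ 2 * ‖Z y‖ ^ 2| + |2 * c y * φ y * ⟪Z y, ∇ φ y⟫| := abs_add_le _ _
      _ ≤ M ^ 2 * 32 ^ 2 / (1 + ‖y‖) ^ 6 + 2 * 8 * M * (32 * (M' * 8)) / (1 + ‖y‖) ^ 6 :=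
          add_le_add h1 h2
      _ = (M ^ 2 * 32 ^ 2 + 2 * 8 * M * (32 * (M' * 8))) / (1 + ‖y‖) ^ 6 := by ring
  -- the integration by parts
  have hIBP := integral_mul_divergence_add_eq_zero_of_integrable hθ hZs hI1 hI2 hI3
  -- read off the identity
  have hlhs : ∫ y, φ y ^ 2 * c y * VectorCalculus.divergence Z y = -2 * ∫ y, c y ^ 4 * φ y ^ 2 := by
    rw [← integral_const_mul]
    refine integral_congr_ae (Eventually.of_forall fun y ↦ ?_)
    simp only [hdiv]
    ring
  have hI3' : Integrable (fun y ↦ φ y ^ 2 * ‖Z y‖ ^ 2 + 2 * c y * φ y * ⟪Z y, ∇ φ y⟫) :=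
    hI3.congr (Eventually.of_forall hinner)
  refine ⟨hI3', ?_⟩
  have hrhs : ∫ y, ⟪Z y, ∇ (fun y ↦ φ y ^ 2 * c y) y⟫ =
      ∫ y, (φ y ^ 2 * ‖Z y‖ ^ 2 + 2 * c y * φ y * ⟪Z y, ∇ φ y⟫) :=
    integral_congr_ae (Eventually.of_forall hinner)
  rw [hlhs, hrhs] at hIBP
  have hgoal : ∫ y, (φ y ^ 2 * ‖Z y‖ ^ 2 + 2 * c y * φ y * ⟪Z y, ∇ φ y⟫) =
      2 * ∫ y, c y ^ 4 * φ y ^ 2 := by linarith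
  exact hgoal

end IBP

variable (V : Type*) [NormedAddCommGroup V] [InnerProductSpace ℝ V] {n : ℕ}
  [Fact (finrank ℝ V = n + 1)]

/-! ### The round `Sⁿ` in Mathlib's stereographic charts: smoothness, `|dψ|²`, integrals -/

section Chart

/-- The inverse extended chart `σ⁻¹ = (extChartAt (𝓡 n) v)⁻¹` of the sphere (inverse
stereographic projection from `−v` after an isometry `ℝⁿ ≃ (−v)ᗮ`) is smooth on all of `ℝⁿ`
(its target is `ℝⁿ`). [folklore] -/
theorem contMDiff_extChartAt_symm_sphere (v : sphere (0 : V) 1) (m : ℕ∞ω) :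
    ContMDiff 𝓘(ℝ, EuclideanSpace ℝ (Fin n)) (𝓡 n) m (extChartAt (𝓡 n) v).symm := by
  have htgt : (extChartAt (𝓡 n) v).target = univ := by
    rw [extChartAt_target, ModelWithCorners.range_eq_univ, inter_univ,
      modelWithCornersSelf_coe_symm, preimage_id_eq, id]
    exact stereographic'_target (-v)
  have h := contMDiffOn_extChartAt_symm (I := 𝓡 n) (n := m) v
  rwa [htgt, contMDiffOn_univ] at h

/-- The differential of `σ⁻¹` is injective everywhere. [folklore] -/
theorem injective_mfderiv_extChartAt_symm_sphere (v : sphere (0 : V) 1)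
    (y : EuclideanSpace ℝ (Fin n)) :
    Function.Injective
      (mfderiv 𝓘(ℝ, EuclideanSpace ℝ (Fin n)) (𝓡 n) (extChartAt (𝓡 n) v).symm y) := by
  have hfun : ((extChartAt (𝓡 n) v).symm : EuclideanSpace ℝ (Fin n) → sphere (0 : V) 1) =
      (chartAt (EuclideanSpace ℝ (Fin n)) v).symm := by
    rw [extChartAt_coe_symm, modelWithCornersSelf_coe_symm]
    rfl
  rw [hfun]
  have hy : y ∈ (chartAt (EuclideanSpace ℝ (Fin n)) v).target := by
    change y ∈ (stereographic' n (-v)).target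
    rw [stereographic'_target]
    exact mem_univ y
  exact (mdifferentiable_chart (I := 𝓡 n) v).symm.mfderiv_injective hy

/-- **The round metric pulled back by the stereographic chart is conformally flat**, as a
bilinear identity: `g_S(dσ⁻¹_y X, dσ⁻¹_y W) = (4/(‖y‖²+4))² ⟪X, W⟫` for all `X, W ∈ ℝⁿ`
(`roundMetric_apply`, chain rule, `inner_fderiv_stereoInvFunAux` of `RoundSphereVolume.lean`;
Lee 2018, Ch. 3: `(σ⁻¹)^* g̊ = 4|du|²/(1+|u|²)²` in the unscaled normalisation `u = y/2`).
[cite: Lee2018, Ch. 3, stereographic coordinates] -/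
theorem roundMetric_mfderiv_extChartAt_symm (v : sphere (0 : V) 1) (y : EuclideanSpace ℝ (Fin n))
    (X W : EuclideanSpace ℝ (Fin n)) :
    (roundMetric (n := n) V).val ((extChartAt (𝓡 n) v).symm y)
        (mfderiv 𝓘(ℝ, EuclideanSpace ℝ (Fin n)) (𝓡 n) (extChartAt (𝓡 n) v).symm y X)
        (mfderiv 𝓘(ℝ, EuclideanSpace ℝ (Fin n)) (𝓡 n) (extChartAt (𝓡 n) v).symm y W) =
      (4 / (‖y‖ ^ 2 + 4)) ^ 2 * ⟪X, W⟫ := by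
  haveI : FiniteDimensional ℝ V := .of_fact_finrank_eq_succ n
  set σ := chartAt (EuclideanSpace ℝ (Fin n)) v with hσ
  have hfun : ((extChartAt (𝓡 n) v).symm : EuclideanSpace ℝ (Fin n) → sphere (0 : V) 1) =
      σ.symm := by
    rw [extChartAt_coe_symm, modelWithCornersSelf_coe_symm]
    rfl
  rw [hfun, roundMetric_apply]
  have hy : y ∈ σ.target := by
    rw [hσ]
    change y ∈ (stereographic' n (-v)).target
    rw [stereographic'_target]
    exact mem_univ y
  have hσd : MDifferentiableAt 𝓘(ℝ, EuclideanSpace ℝ (Fin n)) (𝓡 n) σ.symm y :=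
    (mdifferentiable_chart (I := 𝓡 n) v).mdifferentiableAt_symm hy
  have hcoe : MDifferentiableAt (𝓡 n) 𝓘(ℝ, V) ((↑) : sphere (0 : V) 1 → V) (σ.symm y) :=
    (contMDiff_coe_sphere (m := 1)).mdifferentiableAt one_ne_zero
  have hchain : ∀ ξ : EuclideanSpace ℝ (Fin n),
      mfderiv (𝓡 n) 𝓘(ℝ, V) ((↑) : sphere (0 : V) 1 → V) (σ.symm y)
          (mfderiv 𝓘(ℝ, EuclideanSpace ℝ (Fin n)) (𝓡 n) σ.symm y ξ) =
        fderiv ℝ (fun z ↦ ((σ.symm z : sphere (0 : V) 1) : V)) y ξ := by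
    intro ξ
    have hc := mfderiv_comp y hcoe hσd
    rw [← ContinuousLinearMap.comp_apply, ← hc, ← mfderiv_eq_fderiv]
    rfl
  rw [hchain, hchain]
  set p : V := ((-v : sphere (0 : V) 1) : V) with hp
  set U : (ℝ ∙ p)ᗮ ≃ₗᵢ[ℝ] EuclideanSpace ℝ (Fin n) :=
    (OrthonormalBasis.fromOrthogonalSpanSingleton n (ne_zero_of_mem_unit_sphere (-v))).repr with hU
  set T : EuclideanSpace ℝ (Fin n) →L[ℝ] V :=
    (ℝ ∙ p)ᗮ.subtypeL.comp U.symm.toContinuousLinearEquiv.toContinuousLinearMap with hT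
  have hT_apply : ∀ z, T z = ((U.symm z : (ℝ ∙ p)ᗮ) : V) := fun z ↦ rfl
  have hformula : (fun z ↦ ((σ.symm z : sphere (0 : V) 1) : V)) = stereoInvFunAux p ∘ T := by
    funext z
    rfl
  have hfd : ∀ ξ : EuclideanSpace ℝ (Fin n),
      fderiv ℝ (fun z ↦ ((σ.symm z : sphere (0 : V) 1) : V)) y ξ =
        fderiv ℝ (stereoInvFunAux p) (T y) (T ξ) := by
    intro ξ
    rw [hformula, fderiv_comp y (differentiableAt_stereoInvFunAux p (T y)) T.differentiableAt,
      ContinuousLinearMap.fderiv, ContinuousLinearMap.comp_apply]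
  rw [hfd, hfd]
  have hpn : ‖p‖ = 1 := by rw [hp]; exact norm_eq_of_mem_sphere (-v)
  have horth : ∀ z, ⟪p, T z⟫ = 0 := fun z ↦ by
    rw [hT_apply]
    exact Submodule.mem_orthogonal_singleton_iff_inner_right.1 (U.symm z).2
  change ⟪fderiv ℝ (stereoInvFunAux p) (T y) (T X), fderiv ℝ (stereoInvFunAux p) (T y) (T W)⟫ = _
  rw [inner_fderiv_stereoInvFunAux hpn (horth y) (horth _) (horth _)]
  have hTnorm : ‖T y‖ = ‖y‖ := by
    rw [hT_apply, Submodule.norm_coe, LinearIsometryEquiv.norm_map]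
  have hTinner : ⟪T X, T W⟫ = ⟪X, W⟫ := by
    rw [hT_apply, hT_apply, ← Submodule.coe_inner, LinearIsometryEquiv.inner_map_map]
  rw [hTnorm, hTinner]

variable {V}

/-- `mvfderiv` on a normed space is `fderiv` (as `MinkowskiFlat.mvfderiv_eq_fderiv`, restated to
keep the imports of this file small). [folklore] -/
theorem mvfderiv_eq_fderiv_self {F G : Type*} [NormedAddCommGroup F] [NormedSpace ℝ F]
    [NormedAddCommGroup G] [NormedSpace ℝ G] (f : F → G) (x : F) (w : TangentSpace 𝓘(ℝ, F) x) :
    mvfderiv 𝓘(ℝ, F) f x w = fderiv ℝ f x w := by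
  simp only [mvfderiv, ContinuousLinearMap.comp_apply, mfderiv_eq_fderiv]
  rfl

/-- **`|dψ|²_{g_S}` read in the stereographic chart**: for `ψ` differentiable at `σ⁻¹ y`,
`g_S⁻¹(dψ, dψ)(σ⁻¹ y) = (4/(‖y‖²+4))⁻² ‖∇(ψ ∘ σ⁻¹)(y)‖²` — naturality of `g⁻¹` along the
local diffeomorphism `σ⁻¹` (`innerDual_mvfderiv_comp`, `EndChartIntegral.lean`) and `♯` for the
pulled-back metric `c² δ` (`sharp_eq_of_forall`): `♯α = c⁻² α^♯_δ`. This is `|∇ψ|²_g = c⁻²|∇ψ̃|²`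
of Lee–Parker 1987, §3 (3.4). [cite: LeeParker1987, §3, (3.4)] -/
theorem innerDual_mvfderiv_roundMetric_extChartAt_symm (v : sphere (0 : V) 1)
    (y : EuclideanSpace ℝ (Fin n)) {ψ : sphere (0 : V) 1 → ℝ}
    (hψ : MDifferentiableAt (𝓡 n) 𝓘(ℝ, ℝ) ψ ((extChartAt (𝓡 n) v).symm y)) :
    (roundMetric (n := n) V).innerDual ((extChartAt (𝓡 n) v).symm y)
        (mvfderiv (𝓡 n) ψ ((extChartAt (𝓡 n) v).symm y)).toLinearMap
        (mvfderiv (𝓡 n) ψ ((extChartAt (𝓡 n) v).symm y)).toLinearMap =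
      ((4 / (‖y‖ ^ 2 + 4)) ^ 2)⁻¹ * ‖∇ (ψ ∘ (extChartAt (𝓡 n) v).symm) y‖ ^ 2 := by
  haveI : FiniteDimensional ℝ V := .of_fact_finrank_eq_succ n
  set Φ : EuclideanSpace ℝ (Fin n) → sphere (0 : V) 1 := fun z ↦ (extChartAt (𝓡 n) v).symm z
    with hΦ
  have hΦs : ContMDiff 𝓘(ℝ, EuclideanSpace ℝ (Fin n)) (𝓡 n) (∞ + 1) Φ :=
    contMDiff_extChartAt_symm_sphere V v _
  have hΦ' : ∀ u, Function.Injective (mfderiv 𝓘(ℝ, EuclideanSpace ℝ (Fin n)) (𝓡 n) Φ u) :=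
    injective_mfderiv_extChartAt_symm_sphere V v
  have hdim : finrank ℝ (EuclideanSpace ℝ (Fin n)) = finrank ℝ (EuclideanSpace ℝ (Fin n)) := rfl
  set G := (roundMetric (n := n) V).comap contMDiff_pullbackBilin_holds Φ hΦs hΦ' hdim with hG
  rw [← (roundMetric (n := n) V).innerDual_mvfderiv_comp contMDiff_pullbackBilin_holds hΦs hΦ' hdim
    y hψ hψ]
  -- the pulled-back metric is `c² ⟪·,·⟫`
  set c : ℝ := 4 / (‖y‖ ^ 2 + 4) with hc
  have hcpos : 0 < c := by positivity
  have hval : ∀ X W : EuclideanSpace ℝ (Fin n), G.val y X W = c ^ 2 * ⟪X, W⟫ := fun X W ↦ by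
    rw [hG, val_comap, pullbackBilin_apply]
    exact roundMetric_mfderiv_extChartAt_symm V v y X W
  -- the covector `d(ψ ∘ Φ)_y` and its Euclidean gradient
  set α := (mvfderiv 𝓘(ℝ, EuclideanSpace ℝ (Fin n)) (ψ ∘ Φ) y).toLinearMap with hα
  have hα_apply : ∀ W : EuclideanSpace ℝ (Fin n), α W = ⟪∇ (ψ ∘ Φ) y, W⟫ := fun W ↦ by
    rw [hα, ContinuousLinearMap.coe_coe, mvfderiv_eq_fderiv_self, gradient, toDual_symm_apply]
  have hsharp : G.sharp y α = (c ^ 2)⁻¹ • ∇ (ψ ∘ Φ) y := by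
    refine sharp_eq_of_forall G y α _ fun W ↦ ?_
    rw [hval, inner_smul_left, hα_apply]
    simp only [map_inv₀, map_pow, RCLike.conj_to_real]
    field_simp
  change α (G.sharp y α) = _
  rw [hsharp]
  erw [hα_apply ((c ^ 2)⁻¹ • ∇ (ψ ∘ Φ) y)]
  rw [inner_smul_right, real_inner_self_eq_norm_sq]


section Integrals

variable (V)
variable [MeasurableSpace V] [BorelSpace V] [NeZero n]

/-- The complement of a stereographic chart domain — the point `−v` — is `dV`-null (chart formula
at `−v` over a Lebesgue-null singleton), so the Riemannian measure of the round sphere restricted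
to the chart domain is the whole measure. [folklore] -/
theorem restrict_riemannianMeasure_extChartAt_source_roundMetric (v : sphere (0 : V) 1) :
    (riemannianMeasure ((roundMetric (n := n) V).toContMDiffRiemannianMetric
        isRiemannian_roundMetric)).restrict (extChartAt (𝓡 n) v).source =
      riemannianMeasure ((roundMetric (n := n) V).toContMDiffRiemannianMetric
        isRiemannian_roundMetric) := by
  haveI : FiniteDimensional ℝ V := .of_fact_finrank_eq_succ n
  set G := (roundMetric (n := n) V).toContMDiffRiemannianMetric isRiemannian_roundMetric with hG
  set μ : Measure (sphere (0 : V) 1) := riemannianMeasure G with hμ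
  have hpt : μ {-v} = 0 := by
    have h := riemannianMeasure_eq_integral_sqrt_det_holds G (-v) (measurableSet_singleton (-v))
      (singleton_subset_iff.2 (mem_extChartAt_source (-v)))
    rw [hμ, h, image_singleton]
    exact setLIntegral_measure_zero _ _ (measure_singleton _)
  have hsrc : (extChartAt (𝓡 n) v).source = {-v}ᶜ := by
    rw [extChartAt_source]
    exact stereographic'_source (-v)
  refine Measure.restrict_eq_self_of_ae_mem ?_
  rw [hsrc, ae_iff]
  simpa using hpt

/-- **Integration over the round sphere in a stereographic chart, Lebesgue integral**: for
measurable `u : Sⁿ → [0,∞]`, `∫_{Sⁿ} u dV = ∫_{ℝⁿ} u(σ⁻¹ y) (4/(‖y‖²+4))ⁿ dy`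
(`setLIntegral_extChartAt_comp`, `sqrt_det_chartGramMatrix_roundMetric`, null complement).
Lee–Parker 1987, §3 (3.3): `dV_g = ρⁿ dy` under stereographic projection.
[cite: LeeParker1987, §3, (3.3)] -/
theorem lintegral_roundMetric_eq_lintegral_chart (v : sphere (0 : V) 1)
    {u : sphere (0 : V) 1 → ENNReal} (hu : Measurable u) :
    ∫⁻ p, u p ∂(riemannianMeasure ((roundMetric (n := n) V).toContMDiffRiemannianMetric
        isRiemannian_roundMetric)) =
      ∫⁻ y : EuclideanSpace ℝ (Fin n), u ((extChartAt (𝓡 n) v).symm y) *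
        ENNReal.ofReal ((4 / (‖y‖ ^ 2 + 4)) ^ n) := by
  haveI : FiniteDimensional ℝ V := .of_fact_finrank_eq_succ n
  set G := (roundMetric (n := n) V).toContMDiffRiemannianMetric isRiemannian_roundMetric with hG
  have htgt : (extChartAt (𝓡 n) v).target = univ := by
    rw [extChartAt_target, ModelWithCorners.range_eq_univ, inter_univ,
      modelWithCornersSelf_coe_symm, preimage_id_eq, id]
    exact stereographic'_target (-v)
  have hcont : Continuous fun y : EuclideanSpace ℝ (Fin n) ↦ (extChartAt (𝓡 n) v).symm y :=
    (contMDiff_extChartAt_symm_sphere V v 0).continuous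
  calc ∫⁻ p, u p ∂(riemannianMeasure G)
      = ∫⁻ p in (extChartAt (𝓡 n) v).source, u p ∂(riemannianMeasure G) := by
        rw [restrict_riemannianMeasure_extChartAt_source_roundMetric]
    _ = ∫⁻ p in (extChartAt (𝓡 n) v).source,
          (u ∘ fun y ↦ (extChartAt (𝓡 n) v).symm y) (extChartAt (𝓡 n) v p)
            ∂(riemannianMeasure G) := by
        refine setLIntegral_congr_fun (isOpen_extChartAt_source v).measurableSet (fun p hp ↦ ?_)
        simp only [Function.comp_apply, (extChartAt (𝓡 n) v).left_inv hp]
    _ = ∫⁻ y in (extChartAt (𝓡 n) v).target, (u ∘ fun y ↦ (extChartAt (𝓡 n) v).symm y) y *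
          ENNReal.ofReal (Real.sqrt (chartGramMatrix G v y).det) :=
        setLIntegral_extChartAt_comp G v ((hu.comp hcont.measurable).aemeasurable)
    _ = ∫⁻ y : EuclideanSpace ℝ (Fin n), u ((extChartAt (𝓡 n) v).symm y) *
          ENNReal.ofReal ((4 / (‖y‖ ^ 2 + 4)) ^ n) := by
        rw [htgt, Measure.restrict_univ]
        refine lintegral_congr (fun y ↦ ?_)
        rw [Function.comp_apply, hG, sqrt_det_chartGramMatrix_roundMetric]

/-- **Integration over the round sphere in a stereographic chart, Bochner integral**: for a
continuous `f : Sⁿ → ℝ`, `y ↦ (4/(‖y‖²+4))ⁿ f(σ⁻¹ y)` is Lebesgue integrable on `ℝⁿ` and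
`∫_{Sⁿ} f dV = ∫_{ℝⁿ} (4/(‖y‖²+4))ⁿ f(σ⁻¹ y) dy` (`setIntegral_extChartAt_comp`,
`integrableOn_extChartAt_comp_iff`). [cite: LeeParker1987, §3, (3.3)] -/
theorem integral_roundMetric_eq_integral_chart (v : sphere (0 : V) 1)
    {f : sphere (0 : V) 1 → ℝ} (hf : Continuous f) :
    Integrable (fun y : EuclideanSpace ℝ (Fin n) ↦
        (4 / (‖y‖ ^ 2 + 4)) ^ n * f ((extChartAt (𝓡 n) v).symm y)) ∧
    ∫ p, f p ∂(riemannianMeasure ((roundMetric (n := n) V).toContMDiffRiemannianMetric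
        isRiemannian_roundMetric)) =
      ∫ y : EuclideanSpace ℝ (Fin n),
        (4 / (‖y‖ ^ 2 + 4)) ^ n * f ((extChartAt (𝓡 n) v).symm y) := by
  haveI : FiniteDimensional ℝ V := .of_fact_finrank_eq_succ n
  have hres := restrict_riemannianMeasure_extChartAt_source_roundMetric V v (n := n)
  set G := (roundMetric (n := n) V).toContMDiffRiemannianMetric isRiemannian_roundMetric with hG
  set μ := riemannianMeasure G with hμ
  haveI : IsFiniteMeasure μ := isFiniteMeasure_riemannianMeasure G
  have htgt : (extChartAt (𝓡 n) v).target = univ := by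
    rw [extChartAt_target, ModelWithCorners.range_eq_univ, inter_univ,
      modelWithCornersSelf_coe_symm, preimage_id_eq, id]
    exact stereographic'_target (-v)
  have hcont : Continuous fun y : EuclideanSpace ℝ (Fin n) ↦ (extChartAt (𝓡 n) v).symm y :=
    (contMDiff_extChartAt_symm_sphere V v 0).continuous
  set g : EuclideanSpace ℝ (Fin n) → ℝ := fun y ↦ f ((extChartAt (𝓡 n) v).symm y) with hgdef
  have hgc : Continuous g := hf.comp hcont
  have hgm : AEStronglyMeasurable g ((volume : Measure (EuclideanSpace ℝ (Fin n))).restrict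
      (extChartAt (𝓡 n) v).target) := hgc.aestronglyMeasurable
  have hsrc : MeasurableSet (extChartAt (𝓡 n) v).source :=
    (isOpen_extChartAt_source v).measurableSet
  -- `g ∘ σ = f` on the chart domain
  have hcongr : ∀ p ∈ (extChartAt (𝓡 n) v).source, g (extChartAt (𝓡 n) v p) = f p := fun p hp ↦ by
    simp only [hgdef, (extChartAt (𝓡 n) v).left_inv hp]
  -- the density is `cⁿ`
  have hdens : ∀ y : EuclideanSpace ℝ (Fin n),
      Real.sqrt (chartGramMatrix G v y).det = (4 / (‖y‖ ^ 2 + 4)) ^ n := fun y ↦ by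
    rw [hG, sqrt_det_chartGramMatrix_roundMetric]
  refine ⟨?_, ?_⟩
  · -- integrability
    have hfi : IntegrableOn (fun p ↦ g (extChartAt (𝓡 n) v p)) (extChartAt (𝓡 n) v).source μ := by
      rw [IntegrableOn, hres]
      have hfint : Integrable f μ := by
        refine ⟨hf.aestronglyMeasurable, ?_⟩
        obtain ⟨C, hC⟩ := isCompact_univ.exists_bound_of_continuousOn hf.continuousOn
        exact HasFiniteIntegral.of_bounded (C := C)
          (Eventually.of_forall fun x ↦ hC x (mem_univ x))
      refine hfint.congr ?_
      have hmem : ∀ᵐ p ∂μ, p ∈ (extChartAt (𝓡 n) v).source := by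
        rw [← hres]
        exact ae_restrict_mem hsrc
      exact hmem.mono fun p hp ↦ (hcongr p hp).symm
    have h2 := (integrableOn_extChartAt_comp_iff G v hgm).1 hfi
    rw [htgt, integrableOn_univ] at h2
    refine h2.congr (Eventually.of_forall fun y ↦ ?_)
    simp only [hdens, smul_eq_mul, hgdef]
  · -- the integral
    calc ∫ p, f p ∂μ = ∫ p in (extChartAt (𝓡 n) v).source, f p ∂μ := by rw [hres]
      _ = ∫ p in (extChartAt (𝓡 n) v).source, g (extChartAt (𝓡 n) v p) ∂μ :=
          setIntegral_congr_fun hsrc (fun p hp ↦ (hcongr p hp).symm)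
      _ = ∫ y in (extChartAt (𝓡 n) v).target, Real.sqrt (chartGramMatrix G v y).det • g y :=
          setIntegral_extChartAt_comp G v hgm
      _ = ∫ y : EuclideanSpace ℝ (Fin n), (4 / (‖y‖ ^ 2 + 4)) ^ n * g y := by
          rw [htgt, Measure.restrict_univ]
          refine integral_congr_ae (Eventually.of_forall fun y ↦ ?_)
          simp only [hdens, smul_eq_mul]

end Integrals

end Chart


/-! ### From compactly supported to decaying functions on `ℝ⁴` -/

section Approximation

variable {E : Type*} [NormedAddCommGroup E] [InnerProductSpace ℝ E] [FiniteDimensional ℝ E]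
  [MeasurableSpace E] [BorelSpace E]

omit [MeasurableSpace E] [BorelSpace E] in
/-- The gradient of the tree's cut-off `Fluid.cutoff R` vanishes on the open ball of radius `R`
(where the cut-off is `1`). [folklore] -/
theorem gradient_cutoff_eq_zero_of_norm_lt {R : ℝ} (hR : 0 < R) {y : E} (hy : ‖y‖ < R) :
    ∇ (cutoff (E := E) R) y = 0 := by
  have h : cutoff (E := E) R =ᶠ[𝓝 y] fun _ ↦ (1 : ℝ) := by
    have hopen : IsOpen {z : E | ‖z‖ < R} := isOpen_lt continuous_norm continuous_const
    filter_upwards [hopen.mem_nhds hy] with z hz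
    exact cutoff_eq_one hR (le_of_lt hz)
  rw [gradient, h.fderiv_eq, fderiv_const_apply, map_zero]

omit [MeasurableSpace E] [BorelSpace E] in
/-- The gradient of `Fluid.cutoff R` vanishes off the closed ball of radius `2R` (where the cut-off
is `0`). [folklore] -/
theorem gradient_cutoff_eq_zero_of_lt_norm {R : ℝ} (hR : 0 < R) {y : E} (hy : 2 * R < ‖y‖) :
    ∇ (cutoff (E := E) R) y = 0 := by
  have h : cutoff (E := E) R =ᶠ[𝓝 y] fun _ ↦ (0 : ℝ) := by
    have hopen : IsOpen {z : E | 2 * R < ‖z‖} := isOpen_lt continuous_const continuous_norm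
    filter_upwards [hopen.mem_nhds hy] with z hz
    exact cutoff_eq_zero hR (le_of_lt hz)
  rw [gradient, h.fderiv_eq, fderiv_const_apply, map_zero]

/-- **A Sobolev-type inequality extends from `C_c^∞` to decaying smooth functions** (dimension
`4`): if `A (∫ v⁴)^{1/2} ≤ B ∫ |∇v|²` for all smooth compactly supported `v`, then the same holds
for every smooth `u` with `u⁴` and `|∇u|²` integrable — the density of `𝒟(ℝ⁴)` in the space
`{u ∈ L⁴ : ∇u ∈ L²}` at the level needed here (Aubin 1982, Thm. 2.14 is stated on `H₁`, the
completion of `𝒟`; Lieb–Loss 2001, Thm. 8.3 and Remark, on `D¹(ℝⁿ)`). Proof: truncations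
`χ_R u` with the tree's cut-offs (`|∇χ_R| ≤ C/R`, supported in `R ≤ |y| ≤ 2R`):
`∫ (χ_R u)⁴ → ∫ u⁴` and `∫ χ_R² |∇u|² → ∫ |∇u|²` by dominated convergence, the error
`∫ u² |∇χ_R|² ≤ (C/R)² (∫_{|y|≥R} u⁴)^{1/2} |B_{2R}|^{1/2} = 4C² |B₁|^{1/2} (∫_{|y|≥R} u⁴)^{1/2}`,
which tends to `0`,
by Hölder (this is where `dim = 4` enters: `|B_{2R}|^{1/2} = 4R² |B₁|^{1/2}`), and the cross term
is `≤ 2 ‖∇u‖₂ (∫ u²|∇χ_R|²)^{1/2} → 0` by Cauchy–Schwarz. [cite: LiebLoss2001, Thm. 8.3] -/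
theorem sobolev_of_compactSupport (h4 : finrank ℝ E = 4) {A B : ℝ}
    (hE : ∀ v : E → ℝ, ContDiff ℝ ∞ v → HasCompactSupport v →
      A * Real.sqrt (∫ y, v y ^ 4) ≤ B * ∫ y, ‖∇ v y‖ ^ 2)
    {u : E → ℝ} (hu : ContDiff ℝ ∞ u) (hu4 : Integrable fun y ↦ u y ^ 4)
    (hgu : Integrable fun y ↦ ‖∇ u y‖ ^ 2) :
    A * Real.sqrt (∫ y, u y ^ 4) ≤ B * ∫ y, ‖∇ u y‖ ^ 2 := by
  haveI : CompleteSpace E := FiniteDimensional.complete ℝ E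
  haveI : Nontrivial E := Module.nontrivial_of_finrank_pos (R := ℝ) (by rw [h4]; norm_num)
  obtain ⟨C, hC0, hC⟩ := exists_norm_fderiv_cutoff_le (E := E)
  -- the truncations `u_m = χ_{m+1} u`
  set χ : ℕ → E → ℝ := fun m ↦ cutoff ((m : ℝ) + 1) with hχ
  set um : ℕ → E → ℝ := fun m y ↦ χ m y * u y with hum
  have hRpos : ∀ m : ℕ, (0 : ℝ) < (m : ℝ) + 1 := fun m ↦ by positivity
  have hχs : ∀ m, ContDiff ℝ ∞ (χ m) := fun m ↦ contDiff_cutoff _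
  have hums : ∀ m, ContDiff ℝ ∞ (um m) := fun m ↦ (hχs m).mul hu
  have humc : ∀ m, HasCompactSupport (um m) := fun m ↦
    (hasCompactSupport_cutoff (hRpos m)).mul_right
  have hineq : ∀ m, A * Real.sqrt (∫ y, um m y ^ 4) ≤ B * ∫ y, ‖∇ (um m) y‖ ^ 2 :=
    fun m ↦ hE (um m) (hums m) (humc m)
  have huc : Continuous u := hu.continuous
  have hgc : Continuous (∇ u) :=
    continuous_gradient_of_contDiff (hu.of_le (by exact_mod_cast le_top))
  have hχc : ∀ m, Continuous (χ m) := fun m ↦ (hχs m).continuous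
  have hgχc : ∀ m, Continuous (∇ (χ m)) := fun m ↦
    continuous_gradient_of_contDiff ((hχs m).of_le (by exact_mod_cast le_top))
  -- (1) `∫ u_m⁴ → ∫ u⁴`
  have h1 : Tendsto (fun m ↦ ∫ y, um m y ^ 4) atTop (𝓝 (∫ y, u y ^ 4)) := by
    refine tendsto_integral_of_dominated_convergence (fun y ↦ u y ^ 4)
      (fun m ↦ (((hχc m).mul huc).pow 4).aestronglyMeasurable) hu4 ?_ ?_
    · intro m
      filter_upwards with y
      rw [Real.norm_eq_abs, hum]
      simp only
      rw [mul_pow, abs_mul, abs_of_nonneg (pow_nonneg (cutoff_nonneg _ _) 4),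
        abs_of_nonneg (by positivity)]
      exact mul_le_of_le_one_left (by positivity)
        (pow_le_one₀ (cutoff_nonneg _ _) (cutoff_le_one _ _))
    · filter_upwards with y
      have := ((tendsto_cutoff_natCast_add_one y).mul_const (u y)).pow 4
      simpa [hum] using this
  -- gradient of the truncation
  have hgrad : ∀ m y, ∇ (um m) y = χ m y • ∇ u y + u y • ∇ (χ m) y := fun m y ↦
    gradient_mul ((hχs m).differentiable (by simp) y) (hu.differentiable (by simp) y)
  have hnormsq : ∀ m y, ‖∇ (um m) y‖ ^ 2 =
      χ m y ^ 2 * ‖∇ u y‖ ^ 2 + (2 * (χ m y * u y) * ⟪∇ u y, ∇ (χ m) y⟫ +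
        u y ^ 2 * ‖∇ (χ m) y‖ ^ 2) := fun m y ↦ by
    rw [hgrad, norm_add_sq_real, norm_smul, norm_smul, inner_smul_left, inner_smul_right,
      Real.norm_eq_abs, Real.norm_eq_abs, mul_pow, mul_pow, sq_abs, sq_abs]
    simp only [RCLike.conj_to_real]
    ring
  -- (2a) `∫ χ_m² |∇u|² → ∫ |∇u|²`
  have h2a : Tendsto (fun m ↦ ∫ y, χ m y ^ 2 * ‖∇ u y‖ ^ 2) atTop (𝓝 (∫ y, ‖∇ u y‖ ^ 2)) := by
    refine tendsto_integral_of_dominated_convergence (fun y ↦ ‖∇ u y‖ ^ 2)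
      (fun m ↦ (((hχc m).pow 2).mul (hgc.norm.pow 2)).aestronglyMeasurable) hgu ?_ ?_
    · intro m
      filter_upwards with y
      rw [Real.norm_eq_abs, abs_of_nonneg (by positivity)]
      exact mul_le_of_le_one_left (by positivity)
        (pow_le_one₀ (cutoff_nonneg _ _) (cutoff_le_one _ _))
    · filter_upwards with y
      have := ((tendsto_cutoff_natCast_add_one y).pow 2).mul_const (‖∇ u y‖ ^ 2)
      simpa using this
  -- the gradient of the cut-off: `‖∇χ_m(y)‖ ≤ C/(m+1)` and `= 0` unless `m+1 ≤ ‖y‖ ≤ 2(m+1)`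
  have hgχ_le : ∀ m y, ‖∇ (χ m) y‖ ≤ C / ((m : ℝ) + 1) := fun m y ↦ by
    rw [gradient, LinearIsometryEquiv.norm_map]
    exact hC _ (hRpos m) y
  have hgχ_zero : ∀ (m : ℕ) (y : E), ‖y‖ < (m : ℝ) + 1 → ∇ (χ m) y = 0 := fun m y hy ↦
    gradient_cutoff_eq_zero_of_norm_lt (hRpos m) hy
  have hgχ_zero' : ∀ (m : ℕ) (y : E), 2 * ((m : ℝ) + 1) < ‖y‖ → ∇ (χ m) y = 0 := fun m y hy ↦
    gradient_cutoff_eq_zero_of_lt_norm (hRpos m) hy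
  -- (2c) `∫ u² |∇χ_m|² → 0`
  set T : ℕ → ℝ := fun m ↦ ∫ y in {y : E | (m : ℝ) + 1 ≤ ‖y‖}, u y ^ 4 with hT
  have hTlim : Tendsto T atTop (𝓝 0) := by
    have hanti : Antitone fun m : ℕ ↦ {y : E | (m : ℝ) + 1 ≤ ‖y‖} := by
      intro m m' hmm' y hy
      simp only [mem_setOf_eq] at hy ⊢
      have : (m : ℝ) ≤ m' := by exact_mod_cast hmm'
      linarith
    have hmeas : ∀ m : ℕ, MeasurableSet {y : E | (m : ℝ) + 1 ≤ ‖y‖} := fun m ↦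
      (isClosed_le continuous_const continuous_norm).measurableSet
    have h := tendsto_setIntegral_of_antitone hmeas hanti ⟨0, hu4.integrableOn⟩
    have hempty : ⋂ m : ℕ, {y : E | (m : ℝ) + 1 ≤ ‖y‖} = ∅ := by
      ext y
      simp only [mem_iInter, mem_setOf_eq, mem_empty_iff_false, iff_false, not_forall, not_le]
      obtain ⟨m, hm⟩ := exists_nat_gt ‖y‖
      exact ⟨m, by linarith⟩
    rw [hempty, Measure.restrict_empty, integral_zero_measure] at h
    exact h
  have hT0 : ∀ m, 0 ≤ T m := fun m ↦ setIntegral_nonneg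
    (isClosed_le continuous_const continuous_norm).measurableSet fun y _ ↦ by positivity
  -- volume of balls
  set V₁ : ℝ := (volume (ball (0 : E) 1)).toReal with hV₁
  have hball : ∀ R : ℝ, 0 ≤ R → (volume (closedBall (0 : E) R)).toReal = R ^ 4 * V₁ := by
    intro R hR
    rw [Measure.addHaar_closedBall_eq_addHaar_ball, Measure.addHaar_ball _ _ hR, h4,
      ENNReal.toReal_mul, ENNReal.toReal_ofReal (by positivity)]
  have hc_bound : ∀ m,
      ∫ y, u y ^ 2 * ‖∇ (χ m) y‖ ^ 2 ≤ 4 * C ^ 2 * Real.sqrt V₁ * Real.sqrt (T m) := by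
    intro m
    set R : ℝ := (m : ℝ) + 1 with hR
    have hR0 : 0 < R := hRpos m
    -- pointwise: `u²|∇χ|² ≤ (C/R)² (u² 1_{R ≤ |y|}) 1_{|y| ≤ 2R}`
    set f : E → ℝ := fun y ↦ ({y : E | R ≤ ‖y‖}).indicator (fun y ↦ u y ^ 2) y with hf
    set g : E → ℝ := fun y ↦ (closedBall (0 : E) (2 * R)).indicator (fun _ ↦ (1 : ℝ)) y with hg
    have hpt : ∀ y, u y ^ 2 * ‖∇ (χ m) y‖ ^ 2 ≤ (C / R) ^ 2 * (f y * g y) := by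
      intro y
      by_cases h1 : ‖y‖ < R
      · rw [hgχ_zero m y h1, norm_zero]
        have : 0 ≤ (C / R) ^ 2 * (f y * g y) := by
          apply mul_nonneg (sq_nonneg _) (mul_nonneg ?_ ?_)
          · exact indicator_nonneg (fun _ _ ↦ sq_nonneg _) _
          · exact indicator_nonneg (fun _ _ ↦ zero_le_one) _
        simpa using this
      by_cases h2 : 2 * R < ‖y‖
      · rw [hgχ_zero' m y h2, norm_zero]
        have : 0 ≤ (C / R) ^ 2 * (f y * g y) := by
          apply mul_nonneg (sq_nonneg _) (mul_nonneg ?_ ?_)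
          · exact indicator_nonneg (fun _ _ ↦ sq_nonneg _) _
          · exact indicator_nonneg (fun _ _ ↦ zero_le_one) _
        simpa using this
      push Not at h1 h2
      have hfy : f y = u y ^ 2 := by rw [hf]; exact indicator_of_mem (by simpa using h1) _
      have hgy : g y = 1 := by
        rw [hg]; exact indicator_of_mem (by simpa [mem_closedBall, dist_zero_right] using h2) _
      rw [hfy, hgy, mul_one, mul_comm]
      gcongr
      exact hgχ_le m y
    -- Hölder
    have hf_nonneg : ∀ y, 0 ≤ f y := fun y ↦ indicator_nonneg (fun _ _ ↦ sq_nonneg _) _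
    have hg_nonneg : ∀ y, 0 ≤ g y := fun y ↦ indicator_nonneg (fun _ _ ↦ zero_le_one) _
    have hSm : MeasurableSet {y : E | R ≤ ‖y‖} :=
      (isClosed_le continuous_const continuous_norm).measurableSet
    have hf_meas : AEStronglyMeasurable f := ((huc.pow 2).aestronglyMeasurable).indicator hSm
    have hf_sq : (fun y ↦ f y ^ 2) = {y : E | R ≤ ‖y‖}.indicator (fun y ↦ u y ^ 4) := by
      funext y
      by_cases hy : y ∈ {y : E | R ≤ ‖y‖}
      · simp only [hf, indicator_of_mem hy]; ring
      · simp only [hf, indicator_of_notMem hy]; ring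
    have hf2 : Integrable (fun y ↦ f y ^ 2) := by
      rw [hf_sq]
      exact hu4.indicator hSm
    have hf_mem : MemLp f (ENNReal.ofReal 2) volume := by
      rw [show ENNReal.ofReal 2 = 2 by norm_num, memLp_two_iff_integrable_sq hf_meas]
      exact hf2
    have hg_mem : MemLp g (ENNReal.ofReal 2) volume := by
      rw [show ENNReal.ofReal 2 = 2 by norm_num]
      exact memLp_indicator_const 2 measurableSet_closedBall (1 : ℝ)
        (Or.inr (measure_closedBall_lt_top).ne)
    have hH := integral_mul_le_Lp_mul_Lq_of_nonneg Real.HolderConjugate.two_two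
      (Eventually.of_forall hf_nonneg) (Eventually.of_forall hg_nonneg) hf_mem hg_mem
    -- evaluate the right-hand side of Hölder
    have hf_int : ∫ y, f y ^ (2 : ℝ) = T m := by
      simp_rw [Real.rpow_two]
      rw [hf_sq, integral_indicator hSm]
    have hg_int : ∫ y, g y ^ (2 : ℝ) = (2 * R) ^ 4 * V₁ := by
      simp_rw [Real.rpow_two]
      have : (fun y ↦ g y ^ 2) = (closedBall (0 : E) (2 * R)).indicator (fun _ ↦ (1 : ℝ)) := by
        funext y
        by_cases hy : y ∈ closedBall (0 : E) (2 * R)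
        · simp only [hg, indicator_of_mem hy]; ring
        · simp only [hg, indicator_of_notMem hy]; ring
      rw [this, integral_indicator measurableSet_closedBall, setIntegral_const, smul_eq_mul,
        mul_one, Measure.real, hball _ (by positivity)]
    rw [hf_int, hg_int] at hH
    -- integrability of both sides of the pointwise bound
    have hKc : IsCompact (closedBall (0 : E) (2 * R) ∩ {y : E | R ≤ ‖y‖}) :=
      (isCompact_closedBall _ _).inter_right (isClosed_le continuous_const continuous_norm)
    have hfg_eq : (fun y ↦ f y * g y) =
        (closedBall (0 : E) (2 * R) ∩ {y : E | R ≤ ‖y‖}).indicator (fun y ↦ u y ^ 2) := by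
      funext y
      by_cases h1 : y ∈ {y : E | R ≤ ‖y‖} <;> by_cases h2 : y ∈ closedBall (0 : E) (2 * R)
      · rw [indicator_of_mem (mem_inter h2 h1)]
        simp only [hf, hg, indicator_of_mem h1, indicator_of_mem h2, mul_one]
      · rw [indicator_of_notMem (fun h ↦ h2 h.1)]
        simp only [hf, hg, indicator_of_mem h1, indicator_of_notMem h2, mul_zero]
      · rw [indicator_of_notMem (fun h ↦ h1 h.2)]
        simp only [hf, hg, indicator_of_notMem h1, zero_mul]
      · rw [indicator_of_notMem (fun h ↦ h1 h.2)]
        simp only [hf, hg, indicator_of_notMem h1, zero_mul]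
    have hfg_int : Integrable (fun y ↦ f y * g y) := by
      rw [hfg_eq]
      exact ((huc.pow 2).continuousOn.integrableOn_compact hKc).integrable_indicator
        hKc.measurableSet
    have hgχsupp : HasCompactSupport (∇ (χ m)) := by
      have h := (hasCompactSupport_cutoff (E := E) (hRpos m)).fderiv (𝕜 := ℝ)
      exact h.comp_left (g := fun L ↦ (toDual ℝ E).symm L) (map_zero _)
    have hsupp2 : HasCompactSupport (fun y ↦ ‖∇ (χ m) y‖ ^ 2) :=
      hgχsupp.norm.comp_left (g := fun t : ℝ ↦ t ^ 2) (by simp)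
    have hlhs_int : Integrable (fun y ↦ u y ^ 2 * ‖∇ (χ m) y‖ ^ 2) :=
      ((huc.pow 2).mul ((hgχc m).norm.pow 2)).integrable_of_hasCompactSupport hsupp2.mul_left
    -- Hölder's right-hand side, in square roots
    have hH' : ∫ y, f y * g y ≤ Real.sqrt (T m) * Real.sqrt ((2 * R) ^ 4 * V₁) := by
      have h := hH
      rw [show (1 / 2 : ℝ) = 1 / 2 from rfl] at h
      rwa [← Real.sqrt_eq_rpow, ← Real.sqrt_eq_rpow] at h
    have hV₁0 : 0 ≤ V₁ := ENNReal.toReal_nonneg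
    calc ∫ y, u y ^ 2 * ‖∇ (χ m) y‖ ^ 2 ≤ ∫ y, (C / R) ^ 2 * (f y * g y) :=
          integral_mono hlhs_int (hfg_int.const_mul _) hpt
      _ = (C / R) ^ 2 * ∫ y, f y * g y := integral_const_mul _ _
      _ ≤ (C / R) ^ 2 * (Real.sqrt (T m) * Real.sqrt ((2 * R) ^ 4 * V₁)) := by gcongr
      _ = 4 * C ^ 2 * Real.sqrt V₁ * Real.sqrt (T m) := by
          rw [show (2 * R) ^ 4 * V₁ = (4 * R ^ 2) ^ 2 * V₁ by ring, Real.sqrt_mul (by positivity),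
            Real.sqrt_sq (by positivity)]
          field_simp
  -- (2c) `c_m = ∫ u² |∇χ_m|² → 0`
  have hc_nonneg : ∀ m, 0 ≤ ∫ y, u y ^ 2 * ‖∇ (χ m) y‖ ^ 2 := fun m ↦
    integral_nonneg fun y ↦ by positivity
  have h2c : Tendsto (fun m ↦ ∫ y, u y ^ 2 * ‖∇ (χ m) y‖ ^ 2) atTop (𝓝 0) := by
    have hup : Tendsto (fun m ↦ 4 * C ^ 2 * Real.sqrt V₁ * Real.sqrt (T m)) atTop (𝓝 0) := by
      have := (Real.continuous_sqrt.tendsto 0).comp hTlim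
      rw [Real.sqrt_zero] at this
      simpa using this.const_mul (4 * C ^ 2 * Real.sqrt V₁)
    exact squeeze_zero hc_nonneg hc_bound hup
  -- integrability of the three pieces of `|∇u_m|²`
  have hgχsupp : ∀ m, HasCompactSupport (∇ (χ m)) := fun m ↦ by
    have h := (hasCompactSupport_cutoff (E := E) (hRpos m)).fderiv (𝕜 := ℝ)
    exact h.comp_left (g := fun L ↦ (toDual ℝ E).symm L) (map_zero _)
  have ha_int : ∀ m, Integrable (fun y ↦ χ m y ^ 2 * ‖∇ u y‖ ^ 2) := fun m ↦
    hgu.mono' ((((hχc m).pow 2).mul (hgc.norm.pow 2)).aestronglyMeasurable)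
      (Eventually.of_forall fun y ↦ by
        rw [Real.norm_eq_abs, abs_of_nonneg (by positivity)]
        exact mul_le_of_le_one_left (by positivity)
          (pow_le_one₀ (cutoff_nonneg _ _) (cutoff_le_one _ _)))
  have hb_supp : ∀ m, HasCompactSupport (fun y ↦ 2 * (χ m y * u y) * ⟪∇ u y, ∇ (χ m) y⟫) :=
    fun m ↦ (hgχsupp m).mono fun y hy ↦ by
      contrapose! hy
      simp only [mem_support, not_not] at hy ⊢
      simp [hy]
  have hb_int : ∀ m, Integrable (fun y ↦ 2 * (χ m y * u y) * ⟪∇ u y, ∇ (χ m) y⟫) := fun m ↦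
    ((continuous_const.mul ((hχc m).mul huc)).mul (hgc.inner (hgχc m)))
      |>.integrable_of_hasCompactSupport (hb_supp m)
  have hc_supp : ∀ m, HasCompactSupport (fun y ↦ ‖∇ (χ m) y‖ ^ 2) := fun m ↦
    (hgχsupp m).norm.comp_left (g := fun t : ℝ ↦ t ^ 2) (by simp)
  have hc_int : ∀ m, Integrable (fun y ↦ u y ^ 2 * ‖∇ (χ m) y‖ ^ 2) := fun m ↦
    ((huc.pow 2).mul ((hgχc m).norm.pow 2)).integrable_of_hasCompactSupport (hc_supp m).mul_left
  -- (2b) `|∫ 2χ_m u ⟪∇u, ∇χ_m⟫| ≤ 2 (∫|∇u|²)^{1/2} (∫ u²|∇χ_m|²)^{1/2} → 0`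
  have hG0 : 0 ≤ ∫ y, ‖∇ u y‖ ^ 2 := integral_nonneg fun y ↦ by positivity
  have hb_bound : ∀ m, ‖∫ y, 2 * (χ m y * u y) * ⟪∇ u y, ∇ (χ m) y⟫‖ ≤
      2 * (Real.sqrt (∫ y, ‖∇ u y‖ ^ 2) * Real.sqrt (∫ y, u y ^ 2 * ‖∇ (χ m) y‖ ^ 2)) := by
    intro m
    -- Cauchy–Schwarz for `‖∇u‖` and `|u| ‖∇χ_m‖`
    have hf_mem : MemLp (fun y ↦ ‖∇ u y‖) (ENNReal.ofReal 2) volume := by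
      rw [show ENNReal.ofReal 2 = 2 by norm_num,
        memLp_two_iff_integrable_sq hgc.norm.aestronglyMeasurable]
      exact hgu
    have hg_mem : MemLp (fun y ↦ |u y| * ‖∇ (χ m) y‖) (ENNReal.ofReal 2) volume := by
      have hmeas : AEStronglyMeasurable (fun y ↦ |u y| * ‖∇ (χ m) y‖) :=
        ((continuous_abs.comp huc).mul (hgχc m).norm).aestronglyMeasurable
      rw [show ENNReal.ofReal 2 = 2 by norm_num, memLp_two_iff_integrable_sq hmeas]
      refine (hc_int m).congr (Eventually.of_forall fun y ↦ ?_)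
      simp only [mul_pow, sq_abs]
    have hH := integral_mul_le_Lp_mul_Lq_of_nonneg Real.HolderConjugate.two_two
      (Eventually.of_forall fun y ↦ norm_nonneg _)
      (Eventually.of_forall fun y ↦ mul_nonneg (abs_nonneg _) (norm_nonneg _)) hf_mem hg_mem
    rw [← Real.sqrt_eq_rpow, ← Real.sqrt_eq_rpow] at hH
    simp_rw [Real.rpow_two, mul_pow, sq_abs] at hH
    -- pointwise `|2χu⟪∇u,∇χ⟫| ≤ 2 ‖∇u‖ (|u| ‖∇χ‖)`
    have hpt : ∀ y, ‖2 * (χ m y * u y) * ⟪∇ u y, ∇ (χ m) y⟫‖ ≤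
        2 * (‖∇ u y‖ * (|u y| * ‖∇ (χ m) y‖)) := by
      intro y
      rw [Real.norm_eq_abs, abs_mul, abs_mul, abs_two, abs_mul]
      have h1 : |χ m y| ≤ 1 := abs_cutoff_le_one _ _
      have h2 : |⟪∇ u y, ∇ (χ m) y⟫| ≤ ‖∇ u y‖ * ‖∇ (χ m) y‖ := abs_real_inner_le_norm _ _
      calc 2 * (|χ m y| * |u y|) * |⟪∇ u y, ∇ (χ m) y⟫|
          ≤ 2 * (1 * |u y|) * (‖∇ u y‖ * ‖∇ (χ m) y‖) := by gcongr
        _ = 2 * (‖∇ u y‖ * (|u y| * ‖∇ (χ m) y‖)) := by ring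
    calc ‖∫ y, 2 * (χ m y * u y) * ⟪∇ u y, ∇ (χ m) y⟫‖
        ≤ ∫ y, ‖2 * (χ m y * u y) * ⟪∇ u y, ∇ (χ m) y⟫‖ := norm_integral_le_integral_norm _
      _ ≤ ∫ y, 2 * (‖∇ u y‖ * (|u y| * ‖∇ (χ m) y‖)) := by
          refine integral_mono (hb_int m).norm ?_ hpt
          have hprod : Integrable (fun y ↦ ‖∇ u y‖ * (|u y| * ‖∇ (χ m) y‖)) := by
            refine ((hgc.norm).mul ((continuous_abs.comp huc).mul (hgχc m).norm))
              |>.integrable_of_hasCompactSupport ((hgχsupp m).mono fun y hy ↦ ?_)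
            contrapose! hy
            simp only [mem_support, not_not] at hy ⊢
            simp [hy]
          exact hprod.const_mul 2
      _ = 2 * ∫ y, ‖∇ u y‖ * (|u y| * ‖∇ (χ m) y‖) := integral_const_mul _ _
      _ ≤ 2 * (Real.sqrt (∫ y, ‖∇ u y‖ ^ 2) * Real.sqrt (∫ y, u y ^ 2 * ‖∇ (χ m) y‖ ^ 2)) := by
          gcongr
  have h2b : Tendsto (fun m ↦ ∫ y, 2 * (χ m y * u y) * ⟪∇ u y, ∇ (χ m) y⟫) atTop (𝓝 0) := by
    have hup : Tendsto (fun m ↦ 2 * (Real.sqrt (∫ y, ‖∇ u y‖ ^ 2) *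
        Real.sqrt (∫ y, u y ^ 2 * ‖∇ (χ m) y‖ ^ 2))) atTop (𝓝 0) := by
      have := (Real.continuous_sqrt.tendsto 0).comp h2c
      rw [Real.sqrt_zero] at this
      simpa using (this.const_mul (Real.sqrt (∫ y, ‖∇ u y‖ ^ 2))).const_mul 2
    exact squeeze_zero_norm hb_bound hup
  -- (2) `∫ |∇u_m|² → ∫ |∇u|²`
  have h2 : Tendsto (fun m ↦ ∫ y, ‖∇ (um m) y‖ ^ 2) atTop (𝓝 (∫ y, ‖∇ u y‖ ^ 2)) := by
    have heq : ∀ m, ∫ y, ‖∇ (um m) y‖ ^ 2 = (∫ y, χ m y ^ 2 * ‖∇ u y‖ ^ 2) +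
        ((∫ y, 2 * (χ m y * u y) * ⟪∇ u y, ∇ (χ m) y⟫) + ∫ y, u y ^ 2 * ‖∇ (χ m) y‖ ^ 2) := by
      intro m
      have hbc_int : Integrable (fun y ↦ 2 * (χ m y * u y) * ⟪∇ u y, ∇ (χ m) y⟫ +
          u y ^ 2 * ‖∇ (χ m) y‖ ^ 2) := (hb_int m).add (hc_int m)
      rw [integral_congr_ae (Eventually.of_forall fun y ↦ hnormsq m y),
        integral_add (ha_int m) hbc_int, integral_add (hb_int m) (hc_int m)]
    simp_rw [heq]
    simpa using h2a.add (h2b.add h2c)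
  -- (3) pass to the limit in the inequality for `u_m`
  have hlhs : Tendsto (fun m ↦ A * Real.sqrt (∫ y, um m y ^ 4)) atTop
      (𝓝 (A * Real.sqrt (∫ y, u y ^ 4))) :=
    ((Real.continuous_sqrt.tendsto _).comp h1).const_mul A
  have hrhs : Tendsto (fun m ↦ B * ∫ y, ‖∇ (um m) y‖ ^ 2) atTop (𝓝 (B * ∫ y, ‖∇ u y‖ ^ 2)) :=
    h2.const_mul B
  exact le_of_tendsto_of_tendsto' hlhs hrhs hineq


end Approximation

/-! ### The transfer: sharp Sobolev on `ℝ⁴` implies `Y(S⁴,[g_S]) ≥ 8√6 π` -/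

section Transfer

/-- **Aubin's Theorem 6.12 for `S⁴` from the sharp Sobolev inequality on `ℝ⁴`.** Assume the
sharp Euclidean Sobolev inequality in dimension four with Aubin's best constant
`K(4,2)² = ω₄^{-1/2}/2 = √6/(8π)` (Aubin 1982, Thm. 2.14 with `q = 2`, `n = 4`; Aubin 1976,
Talenti 1976), for smooth positive `u` on `ℝ⁴` with `u ∈ L⁴` and `∇u ∈ L²`, written as
`8√6 π (∫ u⁴)^{1/2} ≤ 6 ∫ |∇u|²`. Then `yamabe_roundMetric_sphere_four` holds. Proof: the
conformal invariance of the Yamabe functional under stereographic projection (Aubin 1982,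
Prop. 6.4; Lee–Parker 1987, §3, proof of Thm. 3.3, (3.3)–(3.5)): for `ψ` smooth positive on `S⁴`
and `u = c (ψ ∘ σ⁻¹)`, `∫_{S⁴} ψ⁴ dV = ∫ u⁴` and `∫_{S⁴} (6|dψ|² + 12ψ²) dV = 6 ∫ |∇u|²`
(`integral_roundMetric_eq_integral_chart`, `innerDual_mvfderiv_roundMetric_extChartAt_symm`,
`integral_conformal_cross_terms`), so the Euclidean inequality for `u` is (⋆) for `ψ`
(`yamabe_roundMetric_sphere_four_of_sharpSobolev`).
[cite: Aubin1982, Thm. 6.12] [cite: Aubin1982, Ch. 6, §6.4, Prop.]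
[cite: LeeParker1987, §3, Thm. 3.3] -/
theorem yamabe_roundMetric_sphere_four_of_euclidean_decay
    (hE : ∀ u : EuclideanSpace ℝ (Fin 4) → ℝ, ContDiff ℝ ∞ u → (∀ y, 0 < u y) →
      Integrable (fun y ↦ u y ^ 4) → Integrable (fun y ↦ ‖∇ u y‖ ^ 2) →
      8 * Real.sqrt 6 * Real.pi * Real.sqrt (∫ y, u y ^ 4) ≤ 6 * ∫ y, ‖∇ u y‖ ^ 2) :
    yamabe_roundMetric_sphere_four := by
  refine yamabe_roundMetric_sphere_four_of_sharpSobolev fun ψ hψ hpos ↦ ?_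
  -- a stereographic chart
  haveI : Nontrivial (EuclideanSpace ℝ (Fin 5)) := inferInstance
  obtain ⟨v⟩ : Nonempty (sphere (0 : EuclideanSpace ℝ (Fin 5)) 1) :=
    (NormedSpace.sphere_nonempty.2 zero_le_one).to_subtype
  set Φ : EuclideanSpace ℝ (Fin 4) → sphere (0 : EuclideanSpace ℝ (Fin 5)) 1 :=
    fun y ↦ (extChartAt (𝓡 4) v).symm y with hΦ
  set ψt : EuclideanSpace ℝ (Fin 4) → ℝ := fun y ↦ ψ (Φ y) with hψt
  set c : EuclideanSpace ℝ (Fin 4) → ℝ := fun y ↦ 4 / (‖y‖ ^ 2 + 4) with hc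
  set Z : EuclideanSpace ℝ (Fin 4) → EuclideanSpace ℝ (Fin 4) :=
    fun y ↦ -(8 / (‖y‖ ^ 2 + 4) ^ 2) • y with hZ
  set u : EuclideanSpace ℝ (Fin 4) → ℝ := fun y ↦ c y * ψt y with hu
  have h4 : finrank ℝ (EuclideanSpace ℝ (Fin 4)) = 4 := finrank_euclideanSpace_fin
  have hcpos : ∀ y, 0 < c y := fun y ↦ by rw [hc]; positivity
  -- smoothness of `ψ̃ = ψ ∘ σ⁻¹` and of `u`
  have hΦs : ContMDiff 𝓘(ℝ, EuclideanSpace ℝ (Fin 4)) (𝓡 4) ∞ Φ :=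
    contMDiff_extChartAt_symm_sphere (EuclideanSpace ℝ (Fin 5)) v ∞
  have hψts : ContDiff ℝ ∞ ψt := contMDiff_iff_contDiff.1 (hψ.comp hΦs)
  have hψt1 : ContDiff ℝ 1 ψt := hψts.of_le (by exact_mod_cast le_top)
  have hψtd : ∀ y, DifferentiableAt ℝ ψt y := fun y ↦ hψt1.differentiable one_ne_zero y
  have hcs : ContDiff ℝ ∞ c := contDiff_confFactor
  have hcd : ∀ y, DifferentiableAt ℝ c y := fun y ↦ (hcs.differentiable (by simp)) y
  have hus : ContDiff ℝ ∞ u := hcs.mul hψts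
  have hupos : ∀ y, 0 < u y := fun y ↦ mul_pos (hcpos y) (hpos _)
  -- `|ψ̃| ≤ Mψ`
  obtain ⟨Mψ, hMψ⟩ := isCompact_univ.exists_bound_of_continuousOn hψ.continuous.continuousOn
  have hMψ' : ∀ y, |ψt y| ≤ Mψ := fun y ↦ by
    have := hMψ (Φ y) (mem_univ _)
    rwa [Real.norm_eq_abs] at this
  -- `|dψ|²_g ∘ σ⁻¹ = c⁻² |∇ψ̃|²`
  have hgrad : ∀ y, (roundMetric (n := 4) (EuclideanSpace ℝ (Fin 5))).innerDual
      ((extChartAt (𝓡 4) v).symm y)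
      (mvfderiv (𝓡 4) ψ ((extChartAt (𝓡 4) v).symm y)).toLinearMap
      (mvfderiv (𝓡 4) ψ ((extChartAt (𝓡 4) v).symm y)).toLinearMap =
      (c y ^ 2)⁻¹ * ‖∇ ψt y‖ ^ 2 := fun y ↦
    innerDual_mvfderiv_roundMetric_extChartAt_symm v y (hψ.mdifferentiableAt (by simp))
  -- `‖∇ψ̃‖ ≤ M' c` from the bound of `|dψ|²_g` on the compact sphere
  have hψ1 : ContMDiff (𝓡 4) 𝓘(ℝ, ℝ) 1 ψ := hψ.of_le (by exact_mod_cast le_top)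
  have hDc : Continuous fun x ↦ (roundMetric (n := 4) (EuclideanSpace ℝ (Fin 5))).innerDual x
      (mvfderiv (𝓡 4) ψ x).toLinearMap (mvfderiv (𝓡 4) ψ x).toLinearMap :=
    continuous_innerDual_mvfderiv (roundMetric (n := 4) (EuclideanSpace ℝ (Fin 5))) hψ1 hψ1
  obtain ⟨K, hK⟩ := isCompact_univ.exists_bound_of_continuousOn hDc.continuousOn
  have hK0 : 0 ≤ K := (norm_nonneg _).trans (hK v (mem_univ _))
  have hgradle : ∀ y, ‖∇ ψt y‖ ≤ Real.sqrt K * c y := fun y ↦ by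
    have h1 : ‖∇ ψt y‖ ^ 2 = c y ^ 2 * (roundMetric (n := 4) (EuclideanSpace ℝ (Fin 5))).innerDual
        ((extChartAt (𝓡 4) v).symm y) (mvfderiv (𝓡 4) ψ ((extChartAt (𝓡 4) v).symm y)).toLinearMap
        (mvfderiv (𝓡 4) ψ ((extChartAt (𝓡 4) v).symm y)).toLinearMap := by
      rw [hgrad y, ← mul_assoc, mul_inv_cancel₀ (pow_ne_zero 2 (hcpos y).ne'), one_mul]
    have h2 : ‖∇ ψt y‖ ^ 2 ≤ (Real.sqrt K * c y) ^ 2 := by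
      rw [h1, mul_pow, Real.sq_sqrt hK0, mul_comm]
      have := hK ((extChartAt (𝓡 4) v).symm y) (mem_univ _)
      rw [Real.norm_eq_abs] at this
      exact mul_le_mul_of_nonneg_right ((le_abs_self _).trans this) (sq_nonneg _)
    exact (pow_le_pow_iff_left₀ (norm_nonneg _) (by positivity) two_ne_zero).1 h2
  -- the sphere integrals as Euclidean integrals
  obtain ⟨hint4, hI4⟩ := integral_roundMetric_eq_integral_chart (EuclideanSpace ℝ (Fin 5)) v
    (n := 4) (f := fun x ↦ ψ x ^ 4) (hψ.continuous.pow 4)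
  obtain ⟨hint2, hI2⟩ := integral_roundMetric_eq_integral_chart (EuclideanSpace ℝ (Fin 5)) v
    (n := 4) (f := fun x ↦ ψ x ^ 2) (hψ.continuous.pow 2)
  obtain ⟨hintD, hID⟩ := integral_roundMetric_eq_integral_chart (EuclideanSpace ℝ (Fin 5)) v
    (n := 4) hDc
  -- the cross terms `∫ (ψ̃²|Z|² + 2cψ̃⟨Z,∇ψ̃⟩) = 2 ∫ c⁴ ψ̃²`
  obtain ⟨hIX, hX⟩ := integral_conformal_cross_terms h4 hψt1 hMψ' hgradle
  -- pointwise identities for `u = c ψ̃`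
  have hgradu : ∀ y, ∇ u y = c y • ∇ ψt y + ψt y • Z y := fun y ↦ by
    have h := gradient_mul (hcd y) (hψtd y)
    rw [gradient_confFactor] at h
    exact h
  have hu4 : ∀ y, u y ^ 4 = (4 / (‖y‖ ^ 2 + 4)) ^ 4 * ψ ((extChartAt (𝓡 4) v).symm y) ^ 4 :=
    fun y ↦ by
    simp only [hu, hc, hψt, hΦ]
    ring
  have hnormsq : ∀ y, ‖∇ u y‖ ^ 2 =
      (4 / (‖y‖ ^ 2 + 4)) ^ 4 * (roundMetric (n := 4) (EuclideanSpace ℝ (Fin 5))).innerDual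
          ((extChartAt (𝓡 4) v).symm y) (mvfderiv (𝓡 4) ψ ((extChartAt (𝓡 4) v).symm y)).toLinearMap
          (mvfderiv (𝓡 4) ψ ((extChartAt (𝓡 4) v).symm y)).toLinearMap +
        (ψt y ^ 2 * ‖-(8 / (‖y‖ ^ 2 + 4) ^ 2) • y‖ ^ 2 +
          2 * (4 / (‖y‖ ^ 2 + 4)) * ψt y * ⟪-(8 / (‖y‖ ^ 2 + 4) ^ 2) • y, ∇ ψt y⟫) := fun y ↦ by
    rw [hgradu, hgrad y, norm_add_sq_real, norm_smul, norm_smul, inner_smul_left, inner_smul_right,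
      Real.norm_of_nonneg (hcpos y).le, Real.norm_eq_abs, real_inner_comm (Z y) (∇ ψt y)]
    simp only [mul_pow, sq_abs, hc, hZ, RCLike.conj_to_real]
    have hne : (‖y‖ ^ 2 + 4) ≠ 0 := by positivity
    field_simp
    ring
  -- integrability of `u⁴` and `|∇u|²`
  have hintu4 : Integrable (fun y ↦ u y ^ 4) :=
    hint4.congr (Eventually.of_forall fun y ↦ (hu4 y).symm)
  have hintgrad : Integrable (fun y ↦ ‖∇ u y‖ ^ 2) :=
    (hintD.add hIX).congr (Eventually.of_forall fun y ↦ (hnormsq y).symm)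
  -- the values
  have hval4 : ∫ y, u y ^ 4 = ∫ x, ψ x ^ 4 ∂(riemannianMeasure ((roundMetric (n := 4)
      (EuclideanSpace ℝ (Fin 5))).toContMDiffRiemannianMetric isRiemannian_roundMetric)) := by
    rw [hI4]
    exact integral_congr_ae (Eventually.of_forall hu4)
  have hval2 : ∫ y, (4 / (‖y‖ ^ 2 + 4)) ^ 4 * ψt y ^ 2 = ∫ x, ψ x ^ 2 ∂(riemannianMeasure
      ((roundMetric (n := 4) (EuclideanSpace ℝ (Fin 5))).toContMDiffRiemannianMetric
        isRiemannian_roundMetric)) := hI2.symm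
  have hvalgrad : ∫ y, ‖∇ u y‖ ^ 2 =
      ∫ x, (roundMetric (n := 4) (EuclideanSpace ℝ (Fin 5))).innerDual x
          (mvfderiv (𝓡 4) ψ x).toLinearMap (mvfderiv (𝓡 4) ψ x).toLinearMap
        ∂(riemannianMeasure ((roundMetric (n := 4) (EuclideanSpace ℝ (Fin 5)))
          |>.toContMDiffRiemannianMetric isRiemannian_roundMetric)) +
      2 * ∫ x, ψ x ^ 2 ∂(riemannianMeasure ((roundMetric (n := 4) (EuclideanSpace ℝ (Fin 5)))
          |>.toContMDiffRiemannianMetric isRiemannian_roundMetric)) := by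
    rw [integral_congr_ae (Eventually.of_forall hnormsq), integral_add hintD hIX, hX, hID, hval2]
  -- the Euclidean inequality for `u` is (⋆) for `ψ`
  have key := hE u hus hupos hintu4 hintgrad
  rw [hval4, hvalgrad] at key
  linarith

/-- **Aubin's Theorem 6.12 for `S⁴` from the sharp Sobolev inequality on `𝒟(ℝ⁴)`.** Assume the
sharp Euclidean Sobolev inequality of Aubin 1982, Thm. 2.14 (`‖φ‖_p ≤ K(n,q)‖∇φ‖_q` for
`φ ∈ H₁^q(ℝⁿ)`) in the case `q = 2`, `n = 4`, `p = 4`, `K(4,2)² = ω₄^{-1/2}/2 = √6/(8π)`, for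
smooth compactly supported `φ` (`𝒟(ℝ⁴) ⊂ H₁`), written as `8√6 π (∫ φ⁴)^{1/2} ≤ 6 ∫ |∇φ|²`
(Aubin 1976; Talenti 1976). Then `yamabe_roundMetric_sphere_four` holds: the inequality
extends to smooth `u ∈ L⁴` with `∇u ∈ L²` (`sobolev_of_compactSupport`) and the stereographic
transfer applies (`yamabe_roundMetric_sphere_four_of_euclidean_decay`). This is the tree's form
of "`λ(S⁴) ≥ Λ = n(n−1)ω_n^{2/n}`" (Lee–Parker 1987, Thm. 3.3; Aubin 1982, Thm. 6.12 with
Thm. 2.14). [cite: Aubin1982, Thm. 6.12] [cite: Aubin1982, Thm. 2.14]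
[cite: LeeParker1987, §3, Thm. 3.3] -/
theorem yamabe_roundMetric_sphere_four_of_euclidean
    (hE : ∀ φ : EuclideanSpace ℝ (Fin 4) → ℝ, ContDiff ℝ ∞ φ → HasCompactSupport φ →
      8 * Real.sqrt 6 * Real.pi * Real.sqrt (∫ y, φ y ^ 4) ≤ 6 * ∫ y, ‖∇ φ y‖ ^ 2) :
    yamabe_roundMetric_sphere_four :=
  yamabe_roundMetric_sphere_four_of_euclidean_decay fun _ hu _ hu4 hgu ↦
    sobolev_of_compactSupport finrank_euclideanSpace_fin hE hu hu4 hgu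

end Transfer

end Literature.Geometry.Riemannian

end
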